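import Mathlib
import HarnessLib
import HarnessLib.Audit
import Summits.Langlands.Statement
import Summits.Langlands.Langlands.Theses.CoreAdequacySplit
import Summits.Langlands.Langlands.Theorems.CoreAdequacySplit
import Summits.Langlands.Langlands.Theorems.BrightMateBypass
import Literature.NumberTheory.GaloisRepresentations.ResidualGaloisRep
import Literature.NumberTheory.GaloisRepresentations.AdequateSubgroup
import HarnessLib.Audit.Status.Attr

/-!
Route: LieDefectSplit

# Route LieDefectSplit — inside the no-adequate-layer residual the lifting problem is decided by
WHICH clause of Thorne-adequacy fails on the solvable layers: the cohomological Lie defect H¹(J,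
ad⁰) ≠ 0 (engines exist) versus the degenerate defects (none)

Decomposition node of the Langlands root ladder (cell decomp-langlands, lens 5 «finite/base range +
asymptotic regime + bridge», gen 12; RESIDUAL MODE, lineage blocker first).
TARGET = RSL `CoreAdequacySplit.NoAdequateLayerLifting` stmt-Langlands-27954 (crux rank 2, the
DECLARED RESIDUAL of route-Langlands-CoreAdequacySplit rev 0, never split) — the gen-11 residual
of F† = `OdlyzkoWorldSplit.IrreducibleSmallPrimeLifting` 33907: K a number field, 0 < n, IH = Lift_w
below n, ℓ < 2(n+1), ρ : Γ_K → GL_n(ℚ̄_ℓ) framed with ρ̄|Γ_{K(ζ_ℓ)} absolutely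
irreducible whose image I = τ(Γ_{K(ζ_ℓ)}) is NOT Thorne-adequate and admits NO absolutely
irreducible Thorne-adequate layer J between its perfect core P and I, ρ neither solvably reducible
nor solvably mated; conclusion LiftTail(ρ) (irreducible → geometric → linked to a weakly automorphic
ρ' → weakly automorphic).  A child route with a FRAME item (precedents: CoreAdequacySplit,
NonLiftableResidueReduction, InsolubleInductionCarving); refines
route-Langlands-CoreAdequacySplit:NoAdequateLayerLifting (tag in the docstrings; the parent decl is
used BY NAME via FRAME′).
OBSERVATION.  Thorne-adequacy of a layer J (tree `Subgroup.IsThorneAdequate`; GHTT / BLGG13 Def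
6.1.1 [corpus:paper:arxiv-1106.5586 p21 (BLGG13 App. A Def 6.1.1 = the four clauses; Lemma 6.1.3
normal subgroup of prime-to-ℓ index; Prop 6.2.1 GL₂: ℓ = 3 proj. PSL₂(𝔽₃), ℓ = 5 proj.
PSL₂(𝔽₅)/PGL₂(𝔽₅), else adequate)]; Miagkov–Thorne Def 1.1 [corpus:paper:arxiv-2203.04520 p3
(Miagkov–Thorne 2023 «Automorphy lifting with adequate image», Def 1.1 = the four clauses incl.
H¹(G, ad⁰V) = 0; Thm 1.2 GL_n over CM/TR with p > n²: an AIL engine, never small-prime)]) is the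
conjunction of (i) Hom(J, k) = 0,
(ii) (ad⁰)^J = 0, (iii) H¹(J, ad⁰) = 0, (iv) eigen-spanning.  The clauses fail for DIFFERENT reasons
and only one of them has ever been overcome by a lifting theorem: every printed
automorphy lifting theorem with an irreducible NON-adequate residual image — Kisin 2009 at p = 5
(projective image A₅/S₅, non-exceptional), Khare–Thorne 2017 (the exceptional S₅
[corpus:paper:arxiv-1503.03796 p2 (abstract: p = 5, projective image PGL₂(𝔽₅) ∋ ζ₅ case; dual Selmer
elements no Taylor–Wiles prime kills, from H¹(PGL₂(𝔽₅), Ad(1)) ≠ 0)]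
[corpus:paper:arxiv-1503.03796 p3 (Thm 1.1; «adequacy … boils down to ρ̄|G_{F(ζ_p)} irreducible and
H¹(H, ad⁰) = 0, H the projective image»)]; a GL₄ ordinary instance and «certainly yes» for n > 2
[corpus:paper:arxiv-1503.03796 p4 (Lie classes: inflation from H¹(image, ad⁰); Frobenius at a TW
prime has order prime to p and every class of H¹(PSL₂(𝔽₅), ad⁰) dies on p′-subgroups; auxiliary
primes q_v ≡ 1 (p) with ρ̄(Frob_v) of order divisible by p [Tay]; automorphy mod p^N + level
lowering mod p^N; GL₄ ordinary inadequate instance; «certainly yes» for n > 2)]) — lives on images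
whose ONLY defect is (iii): the «Lie classes» of dual Selmer inflated from H¹(image, ad⁰(1)),
which no Taylor–Wiles prime kills (a Frobenius at a TW prime has order prime to p) and which
Khare–Thorne kill at primes v, q_v ≡ 1 (p), with ρ̄(Frob_v) of order divisible by p, plus
automorphy and level lowering mod p^N [corpus:paper:arxiv-1503.03796 p4 (Lie classes: inflation from
H¹(image, ad⁰); Frobenius at a TW prime has order prime to p and every class of H¹(PSL₂(𝔽₅), ad⁰)
dies on p′-subgroups; auxiliary primes q_v ≡ 1 (p) with ρ̄(Frob_v) of order divisible by p [Tay];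
automorphy mod p^N + level lowering mod p^N; GL₄ ordinary inadequate instance; «certainly yes» for n
> 2)].  And the ASYMPTOTIC REGIME is a THEOREM: Guralnick–Herzig–Tiep 2015 Thm 1.2/1.3
[corpus:paper:arxiv-1311.1786 p3 (Guralnick–Herzig–Tiep, Thm 1.2: p > d ⇒ weakly adequate; Thm 1.3:
p > d ⇒ adequate unless (a) Fermat-solvable or (b)(i)–(vi): PSL₂(p)/SL₂(p) d = (p±1)/2,
SL₂(p)×SL₂(p^a) d = p−1, SL₂(q) p = (q+1)/2, SL₂(2^f) p = 2^f+1, 2·A₇ (4,7), 3·A₆ (3,5), SL₂(3^a) a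
≥ 2; «weak adequacy may fail» below)] — if ℓ exceeds the dimension d of the
I⁺-constituents (so on every row n < ℓ < 2(n+1)) then I is weakly adequate ((ii)+(iv)) and, outside
the Fermat-solvable corner (a), H¹(I, k) = 0, so the ONLY possible defect is Ext¹_I(V,V) =
H¹(I, ad) ≠ 0, on the explicit list (b)(i)–(vi) (PSL₂(p) with d = (p±1)/2: (2,5), (3,7), (4,7), …;
SL₂(9) at (4,5); SL₂(4) ≅ A₅ and 3·A₆ at (3,5); 2·A₇ at (4,7); SL₂(3^a) between distinct
Frobenius twists, e.g. (4,3) [corpus:paper:arxiv-1311.1786 p38–40 (§10 proof of Thm 1.3: H¹(G,k) = 0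
unless (a); the defect is Ext¹_G(V,V) ≠ 0, case list incl. SL₂(3^a): Ext¹ between distinct Frobenius
twists L(3^{a−2}), L(3^{a−1}) [AJL]; Cor 10.3 / 10.6 non-adequate examples)]).
NEW DIAL «SQAL» `SolvablyQuasiAdequateImage ρ`: SOME layer J above the perfect core (J contains
every perfect subgroup of I — first-order `AboveCore`, ⟺ perfectCore I ≤ J, PROVED
`aboveCore_iff_perfectCore_le`), inside I, is absolutely irreducible and QUASI-ADEQUATE := (i) ∧
(ii) ∧ (iv) (`IsQuasiAdequate`: the field texts of `Subgroup.IsThorneAdequate` verbatim,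
(iii) omitted; first-order, inlined).  DEFECT LOCALISATION (node, PROVED): Thorne-adequate ⟺
quasi-adequate ∧ H¹ = 0 (`isThorneAdequate_iff_quasi_and_h1`); SADQ ⟹ SQAL
(`quasiAdequateBetween_of_solvAdequateBetween`, so the dial cuts the RESIDUAL ¬SADQ honestly); an
RSL instance with SQAL carries a quasi-adequate absolutely irreducible layer with
H¹(J, ad⁰) ≠ 0 (`lie_layer_of_instance`) — the Khare–Thorne situation exactly; the slab ℓ ∣ n has no
SQAL instance (`not_solvablyQuasiAdequateImage_of_natCast_eq_zero`, from the tree's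
`Subgroup.adZeroRep_invariants_ne_bot`).
NEW CARVE «D↓» `SolvableDescentShadow ρ` (R1 notice of record, decomp-langlands critic CLEARED row
189 (F2) 2026-08-30 (R1 notice of record: the downward solvable-descent shadow D↓; HOME/STATUS.md
L965; verdicts/verdict189.txt)): in the trace currency of CSD / AUT↑, ρ ≅ ρ₀|_{Γ_K} ⊗ χ for a finite
SOLVABLE GALOIS K/K₀, an irreducible geometric
ρ₀ : Γ_{K₀} → GL_n(ℚ̄_ℓ) with ρ̄₀|Γ_{K₀(ζ_ℓ)} absolutely irreducible and ADQ ∨ SADQ (the parent's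
engine / bridge boxes) and a geometric character χ of Γ_K — the DOWNWARD mirror of the parent's
bridge TRANS; such instances are closed by the parent's kit run downward (Serre_w(ρ₀) from OW ∧ RES,
the W⁺-avatar, LiftTail(ρ₀) from AIL / TRANS at every level, AUT↑ along K/K₀, the twist by the
weakly automorphic χ), so R1 forbids booking them in the residual: they form the bridge cell SBL↓
`DescentShadowLifting` (RSL ∧ D↓, not an item) = the conclusion of the support TRANS↓
`SolvableDescentTransport := OW → RES → W⁺ → AUT↑ → CSD → AIL → TRANS → SBL↓` (PRINT modulo the
binders; unproved item like TRANS).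
THREE CELLS, typed STRUCTURED over the landed g11 twin `Theorems.CoreAdequacy.{LiftBelow, CycIrr,
AdequateCyclotomicImage, SolvablyAdequateImage, LiftTail}` and
`Theorems.BrightMate.{SolvablyReducible,
SolvablyMated}` BY NAME (`CoreAdequacySplit.NoAdequateLayerLifting ↔
Theorems.CoreAdequacy.NoAdequateLayerLifting` is `Iff.rfl`; the new literals D↓ and SQAL are
inlined, each `Iff.rfl` to its
structured def), each = RSL with literals inserted after ¬SADQ, each WEAKER than RSL outright —
`cells_of_rsl` — and Langlands-implied — `Cert.*`: SBL↓ (RSL ∧ D↓, above); LIE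
`LieObstructedLifting`
(RSL ∧ ¬D↓ ∧ SQAL) — ATTACKABLE-BY-ENGINE (the sharp Taylor–Wiles criterion: patching needs only the
ε̄-isotypic Chebotarev obstruction
(H¹(Gal(K(ρ̄,ζ_ℓ)/K(ζ_ℓ)), ad⁰) ⊗ ε̄)^{Gal(K(ζ_ℓ)/K)} = 0, not H¹(I, ad⁰) = 0 — rank-2 PRINT;
Khare–Thorne Lie-class killing when it is non-zero — rank-2 PRINT for the
exceptional S₅, GL₄ ordinary instance [corpus:paper:arxiv-1503.03796 p4 (Lie classes: inflation from
H¹(image, ad⁰); Frobenius at a TW prime has order prime to p and every class of H¹(PSL₂(𝔽₅), ad⁰)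
dies on p′-subgroups; auxiliary primes q_v ≡ 1 (p) with ρ̄(Frob_v) of order divisible by p [Tay];
automorphy mod p^N + level lowering mod p^N; GL₄ ordinary inadequate instance; «certainly yes» for n
> 2)]); contains every HIGH row ℓ > d of RSL outside the Fermat-solvable corner (GHT15).  DEG
`DegenerateLayerLifting` (RSL ∧ ¬D↓ ∧ ¬SQAL) —
the DECLARED RESIDUAL: on every layer above the core (i) fails (ℓ-power quotient; GHT (a)), or (ii)
fails (slab ℓ ∣ n — incl. the dyadic (2,2) world booked by the MinimalLevelDescent lineage,
not re-cut), or (iv) fails (eigen-spanning; by GHT15 Thm 1.2 only when some I⁺-constituent has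
dimension ≥ ℓ, i.e. the LOW range ℓ ≤ n, n ≥ 3; Guralnick's examples), or the layer is
reducible — no engine in print touches a DEG row.  FRAME′ `NoAdequateLayerFrame := RSL → Langlands`
(support = the parent route VERBATIM with RSL abstracted: `frame_of_parent` =
`CoreAdequacySplit.closes` with its ten other binders AIL, W⁺, AUT↑, CSD, TRANS, FRAME, OW, RES,
BRIGHT, A†).
ORBIT-CLOSED (node KERNEL V, PROVED from the g11 tree lemma
`perfectCore_eq_of_normal_of_isSolvable_quotient`): a normal subgroup with solvable quotient has the
same perfect core, so
«some quasi-adequate absolutely irreducible layer above the core» is MONOTONE up the solvable orbit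
(`QuasiAdequateBetween.of_normal_of_isSolvable_quotient`) and ¬SQAL is inherited by
every solvable Galois restriction (`not_quasiAdequateBetween_of_normal_…`): the kit's solvable moves
(AUT↑, CSD) never carry a LIE instance to DEG or back.
RANK-2 ROWS OF RECORD (census-1 GAP table I-L5g11 (jobs j341376/j341391/j341396/j341414;
HOME/census/data/gen_v18/I-L5g11/I-L5g11-instruments.md sha256 9ee5c18caad1…; CLEARED row 189)): at
ℓ = 5 the no-adequate-layer images are those with projective image PSL₂(𝔽₅) ≅ A₅ over K(ζ₅) ONLY —
the PGL₂(𝔽₅)-image groups are ADEQUATE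
(h¹(GL₂(𝔽₅), 𝔤𝔩₂) = 0; BLGG13 Prop 6.2.1's PGL₂ clause is over-cautious), so every rank-2 row is a
LIE row (SQAL holds: clauses (i), (ii), (iv) pass, h¹ = 1) or a slab row (2,2).
It suffices to show X = LIE ∧ DEG ∧ TRANS↓ ∧ (OW ∧ RES ∧ W⁺ ∧ AUT↑ ∧ CSD ∧ AIL ∧ TRANS, the parent's
items dedup-attached) ∧ FRAME′.  Kernel (node `LieDefectSplit.lean` v2, rc 0 · 0 sorry · axioms
propext/Classical.choice/Quot.sound): RSL ⟺ LIE ∧ DEG ∧ SBL↓ OUTRIGHT by TWO excluded middles, on D↓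
then on SQAL (`rsl_iff_cells`, `NoAdequateLayerLifting_route_iff_cells` on the tree ROUTE
decl, `regions_trichotomy` / `regions_disjoint`; 0 EQUIV), `shadow_of_transport` (SBL↓ from TRANS↓ +
the seven kit binders BY NAME), ROOT `closes` (13 binders) := `CoreAdequacySplit.closes …
(rsl_of_cells' …)` → `_root_.Langlands`, child deciding theorem `closes_framed` /
`LieDefectInline.closes_inline` (11 binders, all used; the one-liners are `Iff.rfl` to the
structured cells:
`lie_inline_iff`, `deg_inline_iff`, `transport_inline_iff`, `sqal_clause_iff`, `dsh_clause_iff`;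
`assembly_holds`).
Lean: `LieObstructedLifting ∧ DegenerateLayerLifting ∧ SolvableDescentTransport ∧
OdlyzkoWorldAutomorphy ∧ TransOdlyzkoAutomorphy ∧ SatakeAvatarExistence ∧ SolvableAscentConstituent
∧
CliffordSolvableDescent ∧ AdequateImageLifting ∧ SolvableAdequacyTransport ∧ NoAdequateLayerFrame`

Rationale: WHY THIS LINE. RSL books «small prime, no adequate layer» as one dark residual, but adequacy is a
conjunction of four clauses with different natures: (i), (ii), (iv) are degeneracies of the image as
a LINEAR group (an ℓ-quotient, scalars in ad⁰ when ℓ ∣ n, eigenprojections failing to span — by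
Guralnick–Herzig–Tiep these need a constituent of dimension ≥ ℓ, i.e. ℓ ≤ n, or a Fermat-solvable
image [corpus:paper:arxiv-1311.1786 p3 (Guralnick–Herzig–Tiep, Thm 1.2: p > d ⇒ weakly adequate; Thm
1.3: p > d ⇒ adequate unless (a) Fermat-solvable or (b)(i)–(vi): PSL₂(p)/SL₂(p) d = (p±1)/2,
SL₂(p)×SL₂(p^a) d = p−1, SL₂(q) p = (q+1)/2, SL₂(2^f) p = 2^f+1, 2·A₇ (4,7), 3·A₆ (3,5), SL₂(3^a) a
≥ 2; «weak adequacy may fail» below)]), while (iii) is COHOMOLOGICAL and is exactly the defect of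
the classical small-prime exceptions (A₅/S₅ at p = 5 [corpus:paper:arxiv-1106.5586 p22–24 (Points
0–3: which clause fails — PSL₂(𝔽₅)/PGL₂(𝔽₅) at ℓ = 5 fail ONLY H¹(H, ad⁰) = 0; PSL₂(𝔽₃) at ℓ = 3;
SL₂(3^a), 2·A₅ adequate at ℓ = 3)]; PSL₂(7) in dimensions 3, 4 at p = 7; SL₂(9) ⊂ GL₄ at p = 5;
SL₂(9)·2 ⊂ GL₄ at p = 3 [corpus:paper:arxiv-1311.1786 p38–40 (§10 proof of Thm 1.3: H¹(G,k) = 0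
unless (a); the defect is Ext¹_G(V,V) ≠ 0, case list incl. SL₂(3^a): Ext¹ between distinct Frobenius
twists L(3^{a−2}), L(3^{a−1}) [AJL]; Cor 10.3 / 10.6 non-adequate examples)]). The ONLY lifting
theorems ever proved with an irreducible non-adequate image live on clause (iii): Kisin 2009 (the
ε̄-isotypic part of the inflated H¹ vanishes — Taylor–Wiles still works) and Khare–Thorne 2017 (it
does not — Lie classes, killed at primes of p-divisible Frobenius order with automorphy mod p^N
[corpus:paper:arxiv-1503.03796 p4 (Lie classes: inflation from H¹(image, ad⁰); Frobenius at a TW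
prime has order prime to p and every class of H¹(PSL₂(𝔽₅), ad⁰) dies on p′-subgroups; auxiliary
primes q_v ≡ 1 (p) with ρ̄(Frob_v) of order divisible by p [Tay]; automorphy mod p^N + level
lowering mod p^N; GL₄ ordinary inadequate instance; «certainly yes» for n > 2)]), and Khare–Thorne
state that the method extends to n > 2 and prove a GL₄ instance. Cutting RSL by «is the defect
purely (iii) on some layer above the perfect core» therefore puts every instance with an engine or
an engine-in-waiting into one cell (LIE) — which by GHT15 contains the whole asymptotic regime ℓ > d
— and leaves a smaller, group-theoretically explicit residual (DEG: slab, ℓ-quotients, spanning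
failures at ℓ ≤ d). Imported: finite group cohomology (GHTT/GHT classification, Cline–Parshall–Scott
/ Andersen–Jantzen–Soergel Ext¹ computations as used in GHT15 §10), the Khare–Thorne
deformation-theoretic device (auxiliary primes of p-divisible Frobenius order, R = 𝕋 mod p^N), the
g11 perfect-core API (tree `Theorems.CoreAdequacy`).
WHY THE CARVE (R1, critic row 189 (F2)). The parent's residual booked a kit-closable sub-box:
instances that DESCEND (up to a geometric twist) along a solvable Galois K/K₀ to a ρ₀ inside the
parent's engine/bridge boxes over K₀ — RSL's two R1 clauses quantify over solvable EXTENSIONS of K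
only. They are carved here (literal ¬D↓ in both cruxes) and closed by the support TRANS↓ from the
parent's own binders (OW, RES, W⁺, AUT↑, CSD, AIL, TRANS — dedup-attached, so this route files no
new open mathematics for them). The critic's proposed witness ρ_{f,λ}|_{Γ_K} (f of mod-5 projective
image S₅, K its sign field) satisfies D↓ but is solvably MATED over K itself (f's compatible family
restricted to K is a PSW family through ρ), hence was already outside RSL's typed box; D↓ ∩ RSL is a
kit-closable, conjecturally empty, not provably empty sub-box (e.g. twists of restrictions of an
even geometric ρ₀ : Γ_ℚ → GL₂(ℚ̄₅) with image S₅ — forbidden by Fontaine–Mazur, by no theorem at p =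
5) — exactly the R1 situation, so it is carved rather than argued away.
RANKED CRUXES. rank 2 LIE `LieObstructedLifting` (NEW; ATTACKED; WEAKER than RSL; est. open-problem
— rank-2 totally-real parallel-weight-2 sector PRINT (Kisin 2009 + Khare–Thorne 2017 modulo W⁺),
GL_n n ≥ 3 «certainly yes» but unwritten beyond the GL₄ ordinary instance, general K dark like AIL);
rank 3 DEG `DegenerateLayerLifting` (NEW; DECLARED RESIDUAL; WEAKER than RSL; est. open-problem;
INSTRUMENTABLE by the census GAP table j341376 + one clause column). Dedup-attached parent items
(texts byte-identical to route-Langlands-CoreAdequacySplit rev 1 @24edb36ac99c, statements unchanged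
from rev 0): AIL `AdequateImageLifting` 27953 (crux, rank 4 here), W⁺ `SatakeAvatarExistence` 17415
(crux 5), OW `OdlyzkoWorldAutomorphy` 28903 (crux 6), RES `TransOdlyzkoAutomorphy` 28874 (crux 7);
supports AUT↑ `SolvableAscentConstituent` 27679, CSD `CliffordSolvableDescent` 31695, TRANS
`SolvableAdequacyTransport` 27955. New supports: TRANS↓ `SolvableDescentTransport` (rank 9; PRINT
modulo the binders: Arthur–Clozel + GL_n × GL_1 twisting; est. M), FRAME′ `NoAdequateLayerFrame`
(rank 9; = the parent route verbatim, never staffed on its own), Assembly (rank 1; PROVED in the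
node: `LieDefectInline.assembly_holds`).
KILL CRITERIA. (o) A D↓ instance that the parent's binders do NOT close (a gap in the chain
Serre_w(ρ₀) → avatar → LiftTail(ρ₀) → AUT↑ → twist) would make TRANS↓ false as typed: the chain is
spelled out in TRANS↓'s informal and in the node docstring §«THE CARVE IN DETAIL»; its only
non-binder steps are «trace identity ⇒ equal Frobenius polynomials» and «π ⊗ ψ∘det» (print-routine).
(i) An RSL instance whose image has a quasi-adequate layer with H¹(J, ad⁰) = 0 would contradict
`lie_layer_of_instance` — impossible (proved); so the only way the cut is a costume is if SQAL is
EMPTY on RSL: refuted already in rank 2 by (2,5) proj. PSL₂(𝔽₅) (BLGG13 Point 2 and the census GAP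
table I-L5g11: clauses (i), (ii), (iv) hold, (iii) fails, h¹ = 1 [corpus:paper:arxiv-1106.5586
p22–24 (Points 0–3: which clause fails — PSL₂(𝔽₅)/PGL₂(𝔽₅) at ℓ = 5 fail ONLY H¹(H, ad⁰) = 0;
PSL₂(𝔽₃) at ℓ = 3; SL₂(3^a), 2·A₅ adequate at ℓ = 3)]) — the census column makes this a table; (ii)
a lifting theorem in print for an irreducible ρ̄ whose image fails (i), (ii) or (iv) on every layer
(a DEG row) demotes DEG's residual tag on that row — report on the bus and re-cut; (iii) if the
tribunal shows LIE ≥ Langlands (it is Langlands-implied and strictly inside RSL, so only via a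
dominating hypothesis) the route retargets to DEG's complement inside LIE ∩ {n = 2}.
NOT DECOMPOSED YET. TRANS↓ is deliberately ONE support item (the parent's TRANS precedent), not
split into its five print steps. LIE ⟸ LIE₂ (n = 2: PRINT sector — Kisin 2009 non-exceptional,
Khare–Thorne exceptional, both F totally real, parallel weight 2; general K / other weights dark) ∧
LIE_≥3 (n ≥ 3: Khare–Thorne's announced extension; the GHT15 list names the groups) — the BC3
skeleton birth_LIE.lean files exactly this split with `LieObstructedLifting_of` proved; a further
cut of LIE by «(H¹(I, ad⁰) ⊗ ε̄)^Gal = 0» (sharp-TW sub-cell, where ordinary patching works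
verbatim) vs «≠ 0» (Khare–Thorne sub-cell) is foreseen but needs the ε̄-twist typed over the tree's
`adZeroRep` (definition request, not filed now). DEG ⟸ SLAB (ℓ ∣ n; tree lemma) ∧ COPRIME-DEGENERATE
(ℓ ∤ n: (i)/(iv) failures, ℓ ≤ d or Fermat-solvable) — birth_DEG.lean.
CHEAPEST FALSIFIER. One column added to census-1's GAP table I-L5g11 (jobs j341376/…/j341414,
CLEARED row 189; minutes): for each RSL row (n, ℓ, I) and each layer J ∈ [P, I] print the clause
vector ((i) Hom(J, 𝔽_ℓ) = 0, (ii) no scalars in ad⁰ i.e. ℓ ∤ n, (iv) ℓ′-elements' eigenprojections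
span End(V) [BLGG13 Def 6.1.1(3) form], J absolutely irreducible) and the bit SQAL = «some J passes
all four»; acceptance: (2,5) proj. PSL₂(𝔽₅) rows ↦ SQAL (LIE), every ℓ ∣ n row ↦ ¬SQAL (DEG), (2,3)
no RSL row at all, (4,3) ⊇ SL₂(9)·2 ↦ LIE, (3,5) SL₂(4)/3·A₆ and (3,7)/(4,7) PSL₂(7), (4,5) SL₂(9) ↦
LIE; any HIGH row (n < ℓ) landing in DEG outside the Fermat-solvable type (a) falsifies the GHT15
placement claimed here; an EMPTY LIE column in ranks 3–4 would make the cut vacuous above rank 2 (it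
is not: GHT15 Cor 10.3/10.6).

Novelty: v2 delta (R1 carve): the first DOWNWARD solvable-descent carve of the lineage — D↓ typed
twist-included in the trace currency of CSD/AUT↑, bridged by TRANS↓ from the parent's binders;
nearest prior art = the parent's own UPWARD bridge TRANS 27955 and BLGGT's soluble base change
DISJOINT from K(ρ̄, ζ_ℓ) [corpus:paper:arxiv-1010.2561 p25] (both go up; D↓ goes down to a smaller
field where the image is larger and adequate). Searches RUN (2026-08-30, this seat; logs
folder/.lit): corpus `lit search --hybrid "Lie classes dual Selmer inflation image adjoint
non-adequate automorphy lifting Taylor-Wiles primes cannot kill"` → Whitmore 2022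
[corpus:paper:arxiv-2205.05062 p3 (Whitmore 2022 Def 1.2: Ĝ-adequate = H⁰(H, ĝ⁰∨) = H¹(H, 𝔽_p) =
H¹(H, ĝ⁰∨) = 0 + spanning; «a certain Galois cohomology group (the dual Selmer group) is forced to
vanish … one typically imposes big image hypotheses»; Thm: p ≥ n+4, p ≠ 2n±1 ⇒ irreducible ⇒
adequate)] (adequacy incl. H¹(H, ĝ⁰∨) = 0 as the condition making dual Selmer killable; irreducible
⇒ adequate for p ≥ n+4), Matsumoto 2023, Boxer–Calegari–Gee–Newton–Thorne (Bianchi Ramanujan),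
Caraiani–Shin survey — none treats lifting with an inadequate irreducible image; `lit vsearch` ×2
(prose of the LIE mechanism) → no relevant hit (Brown, Cohomology of Groups; Malle–Testerman);
corpus fts `lit search "automorphy lifting inadequate residual image Lie classes dual Selmer"
--source all` → local: ONLY Khare–Thorne [corpus:paper:arxiv-1503.03796 p4 (Lie classes:  [refs: 10.1017/fms.2023.3, paper:arxiv-1010.2561, paper:arxiv-2205.05062, paper:arxiv-1503.03796, paper:arxiv-2203.04520, doi:10.1017/fms.2023.3, paper:arxiv-1311.1786]

Barriers (technique_class: adequate-image, lie-classes, solvable-descent, perfect-core): - technique_class: adequate-image, lie-classes (Khare–Thorne auxiliary primes of p-divisible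
Frobenius order + R = 𝕋 mod p^N), taylor-wiles-kisin patching (sharp Chebotarev criterion),
finite-group-cohomology (GHTT/GHT15), perfect-core (g11 API)
- Literature.Barriers.Langlands.ResiduallyReducibleBarrierNarrow
(`ResiduallyReducibleBarrierNarrow_holds`; technique class = the residual Čebotarev step «annihilate
the WHOLE dual Selmer group H¹_{ℒ⊥}(ad⁰ρ̄(1)) by Taylor–Wiles primes q ≡ 1 mod p^N at which
ρ̄(Frob_q) is α-regular» [Thorne 2012 Def 2.3 / Prop 4.4]): LIE sits INSIDE the class's failure
locus for a reason the barrier's `blocks:` line does not list (there: a constituent of ad⁰ρ̄(1)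
invisible to every α-regular σ because ρ̄|G_{F(ζ_p)} is reducible/dihedral; here: ρ̄ irreducible but
the classes inflated from H¹(image, ad⁰(1)) restrict to zero on every element of prime-to-p order
[corpus:paper:arxiv-1503.03796 p4 (Lie classes: inflation from H¹(image, ad⁰); Frobenius at a TW
prime has order prime to p and every class of H¹(PSL₂(𝔽₅), ad⁰) dies on p′-subgroups; auxiliary
primes q_v ≡ 1 (p) with ρ̄(Frob_v) of order divisible by p [Tay]; automorphy mod p^N + level
lowering mod p^N; GL₄ ordinary inadequate instance; «certainly yes» for n > 2)]) — and LIE's engine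
EVADES the class exactly as the barrier's own evasions_known do for the reducible case (Thorne 2016:
Steinberg places + R = 𝕋 mod p^N₀): Khare–Thorne replace TW primes by places v with q_v ≡ 1 (p), q_v
≢ 1 (p²) and ρ̄(F

sub-problem: Langlands · status: draft · opened planner-decomp-langlands-writer-1-g5-0 2026-08-30T21:05:57Z · rev 0 · ledger route-Langlands-LieDefectSplit
GENERATED by the gate from the ledger (D-0016/17). Provers cite these decls: `theorem foo : Summit.Langlands.Langlands.Theses.LieDefectSplit.<Decl> := …` in Summits/Langlands/Langlands/Theorems/<Name>.lean.
-/

namespace Summit.Langlands.Langlands.Theses.LieDefectSplit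

open scoped BigOperators Topology Manifold Classical MeasureTheory ProbabilityTheory Matrix InnerProductSpace ComplexConjugate ContinuousMap
open Filter Set Function TopologicalSpace MeasureTheory

attribute [summit_statement] _root_.Langlands

/-- item stmt-Langlands-28415 · crux · rank 2 · open · by planner
why it might fail: Print covers only n = 2 over totally real F in parallel weight 2 (Kisin; Khare–Thorne) and one ordinary GL₄ case; n ≥ 3 is «certainly yes» but unwritten, and general K / irregular weights have no patching at all (TaylorWilesNumericalCoincidence, NonRegularWeight).
sources: KhareThorne2017 = doi:10.1007/s00209-016-1750-6 [corpus:paper:arxiv-1503.03796 p3 (Thm 1.1; «adequacy … boils down to ρ̄|G_{F(ζ_p)} irreducible and H¹(H, ad⁰) = 0, H the projective image»)], [corpus:paper:arxiv-1503.03796 p4 (Lie classes: inflation from H¹(image, ad⁰); Frobenius at a TW prime has order prime to p and every class of H¹(PSL₂(𝔽₅), ad⁰) dies on p′-subgroups; auxiliary primes q_v ≡ 1 (p) with ρ̄(Frob_v) of order divisible by p [Tay]; automorphy mod p^N + level lowering mod p, Kisin2009 = M. Kisin, Moduli of finite flat group schemes, and modularity, Ann. of Math. 170 (2009) (2.2.4)/(3.5.1):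 p = 5 with projective image PGL₂(𝔽₅) excluded only when [F(ζ₅):F] = 2 — the rank-2 LIE rows outside the exceptional one are PRINT (parallel weight 2, F totally real), GuralnickHerzigTiep2015 = arXiv:1311.1786 [corpus:paper:arxiv-1311.1786 p3 (Guralnick–Herzig–Tiep, Thm 1.2: p > d ⇒ weakly adequate; Thm 1.3: p > d ⇒ adequate unless (a) Fermat-solvable or (b)(i)–(vi): PSL₂(p)/SL₂(p) d = (p±1)/2, SL₂(p)×SL₂(p^a) d = p−1, SL₂(q) p = (q+1)/2, SL₂(2^f) p = 2^f+1, 2·A₇, [corpus:paper:arxiv-1311.1786 p38–40 (§10 proof of Thm 1.3: H¹(G,k) = 0 unless (a); the defect is Ext¹_G(V,V) ≠ 0, case list incl. SL₂(3^a): Ext¹ between distinct Frobenius twists L(3^{a−2}), L(3^{a−1}) [AJL]; Cor 10.3 / 10.6 non-adequate examples)], [corpus:paper:arxiv-1106.5586 p22–24 (Points 0–3: which clause fails — PSL₂(𝔽₅)/PGL₂(𝔽₅) at ℓ = 5 fail ONLY H¹(H, ad⁰) = 0; PSL₂(𝔽₃) at ℓ = 3; SL₂(3^a), 2·A₅ adequate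 at ℓ = 3)]
[crux] LIE — LIE-OBSTRUCTED NO-ADEQUATE-LAYER LIFTING (NEW; ATTACKED; WEAKER than RSL 27954 — kernel
`cells_of_rsl` — and Langlands-implied — `Cert.lie_of_langlands`; refines
route-Langlands-CoreAdequacySplit:NoAdequateLayerLifting): RSL (structured over the landed twin
`Theorems.CoreAdequacy` BY NAME) OFF the R1 carve D↓ (hypothesis `¬ SolvableDescentShadow ρ`,
inlined: ρ is no geometric twist of the restriction along a solvable Galois K/K₀ of an
adequate-or-solvably-adequate-imaged irreducible geometric ρ₀ — critic row 189 (F2)) with ONE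
further hypothesis: SQAL — some absolutely irreducible reduction τ of ρ|Γ_{K(ζ_ℓ)} has a layer J
containing every perfect subgroup of the image (⟺ perfect core ≤ J), inside the image, absolutely
irreducible and QUASI-ADEQUATE: (i) every additive character J → 𝔽̄_ℓ vanishes, (ii) (ad⁰)^J = ⊥,
(iv) for every simple J-submodule W of ad⁰ some ℓ′-element h ∈ J and eigenvalue α with tr(e_{h,α}·w)
≠ 0 for some w ∈ W (the field texts of the tree's `Subgroup.IsThorneAdequate`, clause (iii) H¹(J,
ad⁰) = 0 omitted). CONTENT (node `lie_layer_of_instance`, PROVED): on such an instance the layer's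
ONLY adequacy defect is a non-zero H¹(J, ad⁰) — the source of K -/
@[route_item "route-Langlands-LieDefectSplit", crux]
def LieObstructedLifting : Prop :=
  ∀ (K : Type) [Field K] [NumberField K] (n : ℕ) (hcpt : Literature.NumberTheory.Automorphic.isCompact_glFiniteIntegralLevel n K), 0 < n → Summit.Langlands.Langlands.Theorems.CoreAdequacy.LiftBelow n → ∀ (ℓ : ℕ) [Fact ℓ.Prime] (ι : PadicAlgCl ℓ ≃+* ℂ) (ρ : Literature.NumberTheory.GaloisRepresentations.FramedGaloisRep K (PadicAlgCl ℓ) n), ℓ < 2 * (n + 1) → Summit.Langlands.Langlands.Theorems.CoreAdequacy.CycIrr ρ → ¬ Summit.Langlands.Langlands.Theorems.CoreAdequacy.AdequateCyclotomicImage ρ → ¬ Summit.Langlands.Langlands.Theorems.CoreAdequacy.SolvablyAdequateImage ρ → ¬ (∃ (K₀ : Type) (_ : Field K₀) (_ : NumberField K₀) (_ : Algebra K₀ K), IsGalois K₀ K ∧ IsSolvable (K ≃ₐ[K₀] K) ∧ ∃ (ρ₀ : Literature.NumberTheory.GaloisRepresentations.FramedGaloisRep K₀ (PadicAlgCl ℓ)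 n) (χ : Literature.NumberTheory.GaloisRepresentations.FramedGaloisRep K (PadicAlgCl ℓ) 1), ρ₀.toGaloisRep.IsIrreducible ∧ ((∀ᶠ v : IsDedekindDomain.HeightOneSpectrum (NumberField.RingOfIntegers K₀) in cofinite, ρ₀.IsUnramifiedAt v) ∧ ∀ (v : IsDedekindDomain.HeightOneSpectrum (NumberField.RingOfIntegers K₀)) (hv : ((ℓ : ℕ) : NumberField.RingOfIntegers K₀) ∈ v.asIdeal), (Literature.NumberTheory.PAdicHodge.fontainePstAdicCompletion v ℓ hv).IsDeRhamFramed (ρ₀.toLocal v)) ∧ ((∀ᶠ v : IsDedekindDomain.HeightOneSpectrum (NumberField.RingOfIntegers K) in cofinite, χ.IsUnramifiedAt v) ∧ ∀ (v : IsDedekindDomain.HeightOneSpectrum (NumberField.RingOfIntegers K)) (hv : ((ℓ : ℕ) : NumberField.RingOfIntegers K) ∈ v.asIdeal), (Literature.NumberTheory.PAdicHodge.fontainePstAdicCompletion v ℓ hv).IsDeRhamFramed (χ.toLocal v)) ∧ Summit.Langlands.Langlands.Theorems.CoreAdequacy.CycIrr ρ₀ ∧ (Summit.Langlands.Langlands.Theorems.CoreAdequacy.AdequateCyclotomicImage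 ρ₀ ∨ Summit.Langlands.Langlands.Theorems.CoreAdequacy.SolvablyAdequateImage ρ₀) ∧ ∀ g : Field.absoluteGaloisGroup K, Literature.NumberTheory.GaloisRepresentations.FramedRep.trace ρ g = Literature.NumberTheory.GaloisRepresentations.FramedRep.trace χ g * Literature.NumberTheory.GaloisRepresentations.FramedRep.trace (ρ₀.restrictField K) g) → (∃ τ : Field.absoluteGaloisGroup (CyclotomicField ℓ K) →* Matrix.GeneralLinearGroup (Fin n) (Literature.NumberTheory.GaloisRepresentations.padicAlgClResidueField ℓ), (ρ.restrictField (CyclotomicField ℓ K)).IsReductionOf (RingHom.id (Literature.NumberTheory.GaloisRepresentations.padicAlgClResidueField ℓ)) τ ∧ Literature.NumberTheory.GaloisRepresentations.IsAbsIrreducible τ ∧ ∃ J : Subgroup (Matrix.GeneralLinearGroup (Fin n) (Literature.NumberTheory.GaloisRepresentations.padicAlgClResidueField ℓ)), (∀ Q : Subgroup (Matrix.GeneralLinearGroup (Fin n) (Literature.NumberTheory.GaloisRepresentations.padicAlgClResidueField ℓ)), Q ≤ τ.range → ⁅Q, Q⁆ = Q → Q ≤ J) ∧ J ≤ τ.range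 ∧ Literature.NumberTheory.GaloisRepresentations.IsAbsIrreducible J.subtype ∧ (∀ f : Additive J →+ Literature.NumberTheory.GaloisRepresentations.padicAlgClResidueField ℓ, f = 0) ∧ (Literature.NumberTheory.GaloisRepresentations.Subgroup.adZeroRep J).invariants = ⊥ ∧ ∀ W : Subrepresentation (Literature.NumberTheory.GaloisRepresentations.Subgroup.adZeroRep J), IsAtom W → ∃ h : J, (orderOf h.1).Coprime (ringChar (Literature.NumberTheory.GaloisRepresentations.padicAlgClResidueField ℓ)) ∧ ∃ α : Literature.NumberTheory.GaloisRepresentations.padicAlgClResidueField ℓ, ∃ w ∈ W, (Literature.NumberTheory.GaloisRepresentations.eigenprojectionMatrix (h.1 : Matrix (Fin n) (Fin n) (Literature.NumberTheory.GaloisRepresentations.padicAlgClResidueField ℓ)) α * w.1).trace ≠ 0) → ¬ Summit.Langlands.Langlands.Theorems.BrightMate.SolvablyReducible ρ → ¬ Summit.Langlands.Langlands.Theorems.BrightMate.SolvablyMated ι ρ → Summit.Langlands.Langlands.Theorems.CoreAdequacy.LiftTail K n hcpt ℓ ι ρ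

/-- item stmt-Langlands-28416 · crux · rank 3 · open · by planner
why it might fail: Its rows (ℓ ∣ n incl. (2,2), (3,3), (4,2); spanning failures at ℓ ≤ n; Fermat-solvable images) have neither a lifting engine nor a complete classification in print (GHT15 stops at ℓ > d; degree-ℓ constituents: GHT 2017 partial) — dark by design (residual).
sources: GuralnickHerzigTiep2015 [corpus:paper:arxiv-1311.1786 p3 (Guralnick–Herzig–Tiep, Thm 1.2: p > d ⇒ weakly adequate; Thm 1.3: p > d ⇒ adequate unless (a) Fermat-solvable or (b)(i)–(vi): PSL₂(p)/SL₂(p) d = (p±1)/2, SL₂(p)×SL₂(p^a) d = p−1, SL₂(q) p = (q+1)/2, SL₂(2^f) p = 2^f+1, 2·A₇ (4,7), 3·A₆ (3,5),, GuralnickHerzigTiep2017 = J. Eur. Math. Soc. 19 (adequate subgroups and indecomposable modules, degree-p constituents; cited in tree Literature/…/AdequateSubgroup.lean), [corpus:paper:arxiv-1106.5586 p21 (BLGG13 App. A Def 6.1.1 = the four clauses; Lemma 6.1.3 normal subgroup of prime-to-ℓ index; Prop 6.2.1 GL₂: ℓ = 3 proj. PSL₂(𝔽₃), ℓ = 5 proj.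 PSL₂(𝔽₅)/PGL₂(𝔽₅), else adequate)], Literature.NumberTheory.GaloisRepresentations.AdequateSubgroup: `Subgroup.not_isThorneAdequate_of_natCast_eq_zero`, `Subgroup.adZeroRep_invariants_ne_bot` (slab ℓ ∣ n), Guralnick2012 = R. Guralnick, Adequacy of representations of finite groups of Lie type (appendix to Dieulefait), and Adequate subgroups II, Bull. Math. Sci. 2012 (weak adequacy failures for dim ≥ p), census-1 GAP table I-L5g11 (jobs j341376/j341391/j341396/j341414; HOME/census/data/gen_v18/I-L5g11/I-L5g11-instruments.md sha256 9ee5c18caad1…; CLEARED row 189)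
[crux] DEG — DEGENERATE-LAYER NO-ADEQUATE-LAYER LIFTING (NEW; DECLARED RESIDUAL; WEAKER than RSL —
`cells_of_rsl` — and Langlands-implied — `Cert.deg_of_langlands`): RSL (structured, BY NAME) OFF the
R1 carve D↓ (hypothesis `¬ SolvableDescentShadow ρ`, critic row 189 (F2)) with the NEGATION of SQAL
inserted: NO layer J above the perfect core of the image, inside it, is absolutely irreducible and
quasi-adequate — on every layer clause (i) fails (J has an ℓ-power quotient: Guralnick–Herzig–Tiep
type (a), ℓ a Fermat prime and I ℓ-solvable), or (ii) fails (the SLAB ℓ ∣ n: scalars in ad⁰ — node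
`not_solvablyQuasiAdequateImage_of_natCast_eq_zero` from the tree's
`Subgroup.adZeroRep_invariants_ne_bot`; it contains the dyadic rank-2 world (2,2) already booked by
the MinimalLevelDescent / InsolubleResidueReduction / NonLiftableResidueReduction lineage — NOT
re-cut here; and (3,3), (4,2)), or (iv) fails (eigenprojections of ℓ′-elements do not span: by GHT15
Thm 1.2 impossible when ℓ > d, so only in the LOW range ℓ ≤ n from n = 3 on — Guralnick's examples
of irreducible non-weakly-adequate modules [GHT15 §1, Guralnick 2012]), or J is reducible. What is
booked: small prime, solvably irreducibl -/
@[route_item "route-Langlands-LieDefectSplit", crux]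
def DegenerateLayerLifting : Prop :=
  ∀ (K : Type) [Field K] [NumberField K] (n : ℕ) (hcpt : Literature.NumberTheory.Automorphic.isCompact_glFiniteIntegralLevel n K), 0 < n → Summit.Langlands.Langlands.Theorems.CoreAdequacy.LiftBelow n → ∀ (ℓ : ℕ) [Fact ℓ.Prime] (ι : PadicAlgCl ℓ ≃+* ℂ) (ρ : Literature.NumberTheory.GaloisRepresentations.FramedGaloisRep K (PadicAlgCl ℓ) n), ℓ < 2 * (n + 1) → Summit.Langlands.Langlands.Theorems.CoreAdequacy.CycIrr ρ → ¬ Summit.Langlands.Langlands.Theorems.CoreAdequacy.AdequateCyclotomicImage ρ → ¬ Summit.Langlands.Langlands.Theorems.CoreAdequacy.SolvablyAdequateImage ρ → ¬ (∃ (K₀ : Type) (_ : Field K₀) (_ : NumberField K₀) (_ : Algebra K₀ K), IsGalois K₀ K ∧ IsSolvable (K ≃ₐ[K₀] K) ∧ ∃ (ρ₀ : Literature.NumberTheory.GaloisRepresentations.FramedGaloisRep K₀ (PadicAlgCl ℓ) n) (χ : Literature.NumberTheory.GaloisRepresentations.FramedGaloisRep K (PadicAlgCl ℓ) 1), ρ₀.toGaloisRep.IsIrreducible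 ∧ ((∀ᶠ v : IsDedekindDomain.HeightOneSpectrum (NumberField.RingOfIntegers K₀) in cofinite, ρ₀.IsUnramifiedAt v) ∧ ∀ (v : IsDedekindDomain.HeightOneSpectrum (NumberField.RingOfIntegers K₀)) (hv : ((ℓ : ℕ) : NumberField.RingOfIntegers K₀) ∈ v.asIdeal), (Literature.NumberTheory.PAdicHodge.fontainePstAdicCompletion v ℓ hv).IsDeRhamFramed (ρ₀.toLocal v)) ∧ ((∀ᶠ v : IsDedekindDomain.HeightOneSpectrum (NumberField.RingOfIntegers K) in cofinite, χ.IsUnramifiedAt v) ∧ ∀ (v : IsDedekindDomain.HeightOneSpectrum (NumberField.RingOfIntegers K)) (hv : ((ℓ : ℕ) : NumberField.RingOfIntegers K) ∈ v.asIdeal), (Literature.NumberTheory.PAdicHodge.fontainePstAdicCompletion v ℓ hv).IsDeRhamFramed (χ.toLocal v)) ∧ Summit.Langlands.Langlands.Theorems.CoreAdequacy.CycIrr ρ₀ ∧ (Summit.Langlands.Langlands.Theorems.CoreAdequacy.AdequateCyclotomicImage ρ₀ ∨ Summit.Langlands.Langlands.Theorems.CoreAdequacy.SolvablyAdequateImage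 ρ₀) ∧ ∀ g : Field.absoluteGaloisGroup K, Literature.NumberTheory.GaloisRepresentations.FramedRep.trace ρ g = Literature.NumberTheory.GaloisRepresentations.FramedRep.trace χ g * Literature.NumberTheory.GaloisRepresentations.FramedRep.trace (ρ₀.restrictField K) g) → ¬ (∃ τ : Field.absoluteGaloisGroup (CyclotomicField ℓ K) →* Matrix.GeneralLinearGroup (Fin n) (Literature.NumberTheory.GaloisRepresentations.padicAlgClResidueField ℓ), (ρ.restrictField (CyclotomicField ℓ K)).IsReductionOf (RingHom.id (Literature.NumberTheory.GaloisRepresentations.padicAlgClResidueField ℓ)) τ ∧ Literature.NumberTheory.GaloisRepresentations.IsAbsIrreducible τ ∧ ∃ J : Subgroup (Matrix.GeneralLinearGroup (Fin n) (Literature.NumberTheory.GaloisRepresentations.padicAlgClResidueField ℓ)), (∀ Q : Subgroup (Matrix.GeneralLinearGroup (Fin n) (Literature.NumberTheory.GaloisRepresentations.padicAlgClResidueField ℓ)), Q ≤ τ.range → ⁅Q, Q⁆ = Q → Q ≤ J) ∧ J ≤ τ.range ∧ Literature.NumberTheory.GaloisRepresentations.IsAbsIrreducible J.subtype ∧ (∀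 f : Additive J →+ Literature.NumberTheory.GaloisRepresentations.padicAlgClResidueField ℓ, f = 0) ∧ (Literature.NumberTheory.GaloisRepresentations.Subgroup.adZeroRep J).invariants = ⊥ ∧ ∀ W : Subrepresentation (Literature.NumberTheory.GaloisRepresentations.Subgroup.adZeroRep J), IsAtom W → ∃ h : J, (orderOf h.1).Coprime (ringChar (Literature.NumberTheory.GaloisRepresentations.padicAlgClResidueField ℓ)) ∧ ∃ α : Literature.NumberTheory.GaloisRepresentations.padicAlgClResidueField ℓ, ∃ w ∈ W, (Literature.NumberTheory.GaloisRepresentations.eigenprojectionMatrix (h.1 : Matrix (Fin n) (Fin n) (Literature.NumberTheory.GaloisRepresentations.padicAlgClResidueField ℓ)) α * w.1).trace ≠ 0) → ¬ Summit.Langlands.Langlands.Theorems.BrightMate.SolvablyReducible ρ → ¬ Summit.Langlands.Langlands.Theorems.BrightMate.SolvablyMated ι ρ → Summit.Langlands.Langlands.Theorems.CoreAdequacy.LiftTail K n hcpt ℓ ι ρ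

/-- item stmt-Langlands-27953 · crux · rank 4 · open · by planner
why it might fail: Engines need more than the image: polarisation / CM base field, regular weights, local hypotheses at v ∣ ℓ; F† has none of these clauses, so AIL over a general K with irregular weights has no engine (TaylorWilesNumericalCoincidence, NonRegularWeightBarrier).
sources: BLGGT2014 = Ann. Math. 179 [corpus:paper:arxiv-1010.2561 p19 (Thm 2.2.1 = Thorne 2012 Thm 7.1; adequacy def.; Prop 2.1.2 = GHTT Thm 9)] [corpus:paper:arxiv-1010.2561 p20 (Thm 2.3.1/2.3.2)], Thorne2012 JIMJ 11 Thm 7.1, Def 2.3 (bib Thorne2012), ACC+2023 Thm 6.1.1, GHT2015 = arXiv:1311.1786 [corpus:paper:arxiv-1311.1786 p3 (Thm 1.1 = GHTT; Thm 1.2; Thm 1.3 exception list)]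
[crux] AIL — ADEQUATE-IMAGE SMALL-PRIME LIFTING (NEW; the ENGINE CELL; WEAKER than F† 33907 — kernel
`cells_of_fdagger` — and Langlands-implied — `Cert.ail_of_langlands`): F†'s statement VERBATIM with
one extra hypothesis after «ρ̄|Γ_{K(ζ_ℓ)} absolutely irreducible»: some absolutely irreducible
reduction τ of ρ|Γ_{K(ζ_ℓ)} has THORNE-ADEQUATE image (tree `Subgroup.IsThorneAdequate τ.range`) —
literally the image hypothesis of Thorne 2012 Thm 7.1 = BLGGT Thm 2.2.1 / 2.3.1 / ACC+ 6.1.1, which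
carry NO prime threshold. ATTACKABLE-BY-ENGINE verbatim on the polarisable regular sector over CM/TR
fields; dark elsewhere (A†'s transverse darkness). -/
@[route_item "route-Langlands-LieDefectSplit", crux]
def AdequateImageLifting : Prop :=
  ∀ (K : Type) [Field K] [NumberField K] (n : ℕ) (hcpt : Literature.NumberTheory.Automorphic.isCompact_glFiniteIntegralLevel n K), 0 < n → (∀ m : ℕ, m < n → ∀ (K : Type) [Field K] [NumberField K] (hcpt : Literature.NumberTheory.Automorphic.isCompact_glFiniteIntegralLevel m K), 0 < m → ∀ (ℓ : ℕ) [Fact ℓ.Prime] (ι : PadicAlgCl ℓ ≃+* ℂ) (ρ : Literature.NumberTheory.GaloisRepresentations.FramedGaloisRep K (PadicAlgCl ℓ) m), ρ.toGaloisRep.IsIrreducible → ((∀ᶠ v : IsDedekindDomain.HeightOneSpectrum (NumberField.RingOfIntegers K) in cofinite, ρ.IsUnramifiedAt v) ∧ ∀ (v : IsDedekindDomain.HeightOneSpectrum (NumberField.RingOfIntegers K)) (hv : ((ℓ : ℕ) : NumberField.RingOfIntegers K) ∈ v.asIdeal), (Literature.NumberTheory.PAdicHodge.fontainePstAdicCompletion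 v ℓ hv).IsDeRhamFramed (ρ.toLocal v)) → (∃ (π : Literature.NumberTheory.Automorphic.CuspidalAutomorphicRepData m K hcpt) (ρ' : Literature.NumberTheory.GaloisRepresentations.FramedGaloisRep K (PadicAlgCl ℓ) m), π.1.IsLAlgebraic ∧ ρ'.toGaloisRep.IsIrreducible ∧ (∀ᶠ v : IsDedekindDomain.HeightOneSpectrum (NumberField.RingOfIntegers K) in cofinite, SatakeFrobCompatibleAt ι π.1 ρ' v) ∧ ∀ᶠ v : IsDedekindDomain.HeightOneSpectrum (NumberField.RingOfIntegers K) in cofinite, ∃ P P' : Polynomial (Valued.v : Valuation (PadicAlgCl ℓ) NNReal).valuationSubring, ρ.HasFrobCharpolyAt v (P.map (Valued.v : Valuation (PadicAlgCl ℓ) NNReal).valuationSubring.subtype) ∧ ρ'.HasFrobCharpolyAt v (P'.map (Valued.v : Valuation (PadicAlgCl ℓ) NNReal).valuationSubring.subtype) ∧ P.map (IsLocalRing.residue (Valued.v : Valuation (PadicAlgCl ℓ) NNReal).valuationSubring) = P'.map (IsLocalRing.residue (Valued.v : Valuation (PadicAlgCl ℓ) NNReal).valuationSubring)) → ∃ π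 : Literature.NumberTheory.Automorphic.CuspidalAutomorphicRepData m K hcpt, π.1.IsLAlgebraic ∧ ∀ᶠ v : IsDedekindDomain.HeightOneSpectrum (NumberField.RingOfIntegers K) in cofinite, SatakeFrobCompatibleAt ι π.1 ρ v) → ∀ (ℓ : ℕ) [Fact ℓ.Prime] (ι : PadicAlgCl ℓ ≃+* ℂ) (ρ : Literature.NumberTheory.GaloisRepresentations.FramedGaloisRep K (PadicAlgCl ℓ) n), ℓ < 2 * (n + 1) → (ρ.restrictField (CyclotomicField ℓ K)).IsResiduallyAbsIrreducible → (∃ τ : Field.absoluteGaloisGroup (CyclotomicField ℓ K) →* Matrix.GeneralLinearGroup (Fin n) (Literature.NumberTheory.GaloisRepresentations.padicAlgClResidueField ℓ), (ρ.restrictField (CyclotomicField ℓ K)).IsReductionOf (RingHom.id (Literature.NumberTheory.GaloisRepresentations.padicAlgClResidueField ℓ)) τ ∧ Literature.NumberTheory.GaloisRepresentations.IsAbsIrreducible τ ∧ Literature.NumberTheory.GaloisRepresentations.Subgroup.IsThorneAdequate τ.range) → ρ.toGaloisRep.IsIrreducible → ((∀ᶠ v : IsDedekindDomain.HeightOneSpectrum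 (NumberField.RingOfIntegers K) in cofinite, ρ.IsUnramifiedAt v) ∧ ∀ (v : IsDedekindDomain.HeightOneSpectrum (NumberField.RingOfIntegers K)) (hv : ((ℓ : ℕ) : NumberField.RingOfIntegers K) ∈ v.asIdeal), (Literature.NumberTheory.PAdicHodge.fontainePstAdicCompletion v ℓ hv).IsDeRhamFramed (ρ.toLocal v)) → (∃ (π : Literature.NumberTheory.Automorphic.CuspidalAutomorphicRepData n K hcpt) (ρ' : Literature.NumberTheory.GaloisRepresentations.FramedGaloisRep K (PadicAlgCl ℓ) n), π.1.IsLAlgebraic ∧ ρ'.toGaloisRep.IsIrreducible ∧ (∀ᶠ v : IsDedekindDomain.HeightOneSpectrum (NumberField.RingOfIntegers K) in cofinite, SatakeFrobCompatibleAt ι π.1 ρ' v) ∧ ∀ᶠ v : IsDedekindDomain.HeightOneSpectrum (NumberField.RingOfIntegers K) in cofinite, ∃ P P' : Polynomial (Valued.v : Valuation (PadicAlgCl ℓ) NNReal).valuationSubring, ρ.HasFrobCharpolyAt v (P.map (Valued.v : Valuation (PadicAlgCl ℓ) NNReal).valuationSubring.subtype) ∧ ρ'.HasFrobCharpolyAt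 v (P'.map (Valued.v : Valuation (PadicAlgCl ℓ) NNReal).valuationSubring.subtype) ∧ P.map (IsLocalRing.residue (Valued.v : Valuation (PadicAlgCl ℓ) NNReal).valuationSubring) = P'.map (IsLocalRing.residue (Valued.v : Valuation (PadicAlgCl ℓ) NNReal).valuationSubring)) → ∃ π : Literature.NumberTheory.Automorphic.CuspidalAutomorphicRepData n K hcpt, π.1.IsLAlgebraic ∧ ∀ᶠ v : IsDedekindDomain.HeightOneSpectrum (NumberField.RingOfIntegers K) in cofinite, SatakeFrobCompatibleAt ι π.1 ρ v

/-- item stmt-Langlands-17415 · crux · rank 5 · open · by planner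
why it might fail: Known for regular algebraic π over CM/TR fields (HLTT, Scholze) up to irreducibility; open for irregular π and general K (ShimuraVarietyRealizationBarrier).
sources: HLTT2016 Ann. Math. 183, Scholze2015 Ann. Math. 182, Literature.Barriers.Langlands.ShimuraVarietyRealizationBarrier
[crux] W⁺ — for every number field K, n ≥ 1, every L-algebraic cuspidal π of GL_n(𝔸_K) and every (ℓ,
ι) there is an IRREDUCIBLE ρ : Γ_K → GL_n(ℚ̄_ℓ) Satake–Frobenius compatible with (π, ι) at almost
all places (Buzzard–Gee Conj. 3.2.2 weak form + Ramakrishnan's cuspidal ⇒ irreducible; Clozel's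
Conj. 1.1.1 in arXiv:2607.11763). No de Rham clause, no Rec: ε-free and Rec-free. [difficulty:
open-problem] -/
@[route_item "route-Langlands-LieDefectSplit", crux]
def SatakeAvatarExistence : Prop :=
  ∀ (K : Type) [Field K] [NumberField K] (n : ℕ) (hcpt : Literature.NumberTheory.Automorphic.isCompact_glFiniteIntegralLevel n K), 0 < n → ∀ (π : Literature.NumberTheory.Automorphic.CuspidalAutomorphicRepData n K hcpt), π.1.IsLAlgebraic → ∀ (ℓ : ℕ) [Fact ℓ.Prime] (ι : PadicAlgCl ℓ ≃+* ℂ), ∃ ρ : Literature.NumberTheory.GaloisRepresentations.FramedGaloisRep K (PadicAlgCl ℓ) n, ρ.toGaloisRep.IsIrreducible ∧ ∀ᶠ v : IsDedekindDomain.HeightOneSpectrum (NumberField.RingOfIntegers K) in cofinite, SatakeFrobCompatibleAt ι π.1 ρ v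

/-- item stmt-Langlands-28903 · crux · rank 6 · open · by planner
why it might fail: Residual automorphy of every absolutely irreducible odd-free ρ̄ over every number field in the Odlyzko-bounded world is Serre's conjecture beyond GL₂/ℚ: open (known: GL₂ over ℚ, Khare–Wintenberger; pieces over totally real fields).
sources: Summit.Langlands.Langlands.Theses.OdlyzkoWorldSplit.OdlyzkoWorldAutomorphy (stmt-Langlands-28903), KhareWintenberger2009 Invent. Math. 178
[crux] (OW, the FINITE RANGE — the conjunct this node ATTACKS) for every number field K, n ≥ 1,
prime ℓ, ι and every irreducible pinned-geometric ℓ-adic ρ : Γ_K → GL_n(ℚ̄_ℓ) IN the Odlyzko world —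
some number field L ⊇ K, Galois over K, with rd(L) = |d_L|^(1/[L:ℚ]) < Ω(L) = 4πe^(γ + r₁(L)/[L:ℚ])
makes ρ|Γ_L residually projectively scalar at almost all places (⟺ rd(M) < Ω(M), M = K(ℙρ̄^ss)) — ρ
is residually automorphic (same conclusion as Serre_w). Per ε-shell the world is a finite list of
projective residual Galois types (Odlyzko–Poitou + Hermite); print closes the void part (Tate,
Serre, Moon–Taguchi, Şengün, arXiv:2509.00635) and the soluble part over ℚ (Langlands–Tunnell +
anchors); open atoms: AT11 (A₅ over ℚ(√10), ℚ(√11) unramified outside 2), even icosahedral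
conductors 1951/2141/3701, rank-3 small-GRD Hessians, odd-rank trivial-class anchors over generic
small K. [difficulty: open-problem] TAGS (crit-1 CLEARED 2026-08-30T05:29:08Z STATUS L211,
CRITIC-LEDGER row 50; REV 2 ERRATUM (Galois witness field) NODE L221, CLEARED 05:41:20Z L222, row
53; census v6 sha256 840ee3bb…): OW NEW · WEAKER (kernel `ow_of_serre`,
nodes/lens-5-g3-OdlyzkoWorldSplit.lean; probe OW ⇏ Serre_w / Lan -/
@[route_item "route-Langlands-LieDefectSplit", crux]
def OdlyzkoWorldAutomorphy : Prop :=
  ∀ (K : Type) [Field K] [NumberField K] (n : ℕ) (hcpt : Literature.NumberTheory.Automorphic.isCompact_glFiniteIntegralLevel n K), 0 < n → ∀ (ℓ : ℕ) [Fact ℓ.Prime] (ι : PadicAlgCl ℓ ≃+* ℂ) (ρ : Literature.NumberTheory.GaloisRepresentations.FramedGaloisRep K (PadicAlgCl ℓ) n), ρ.toGaloisRep.IsIrreducible → ((∀ᶠ v : IsDedekindDomain.HeightOneSpectrum (NumberField.RingOfIntegers K) in cofinite, ρ.IsUnramifiedAt v) ∧ ∀ (v : IsDedekindDomain.HeightOneSpectrum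 (NumberField.RingOfIntegers K)) (hv : ((ℓ : ℕ) : NumberField.RingOfIntegers K) ∈ v.asIdeal), (Literature.NumberTheory.PAdicHodge.fontainePstAdicCompletion v ℓ hv).IsDeRhamFramed (ρ.toLocal v)) → (∃ (L : Type) (_ : Field L) (_ : NumberField L) (_ : Algebra K L), IsGalois K L ∧ (|(NumberField.discr L : ℝ)|) ^ ((1 : ℝ) / (Module.finrank ℚ L : ℝ)) < 4 * Real.pi * Real.exp (Real.eulerMascheroniConstant + (NumberField.InfinitePlace.nrRealPlaces L : ℝ) / (Module.finrank ℚ L : ℝ)) ∧ ∀ᶠ w : IsDedekindDomain.HeightOneSpectrum (NumberField.RingOfIntegers L) in cofinite, ∃ (P : Polynomial (Valued.v : Valuation (PadicAlgCl ℓ) NNReal).valuationSubring) (a : (Valued.v : Valuation (PadicAlgCl ℓ) NNReal).valuationSubring), (ρ.restrictField L).HasFrobCharpolyAt w (P.map (Valued.v : Valuation (PadicAlgCl ℓ) NNReal).valuationSubring.subtype) ∧ P.map (IsLocalRing.residue (Valued.v : Valuation (PadicAlgCl ℓ) NNReal).valuationSubring) = (Polynomial.X - Polynomial.C (IsLocalRing.residue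 (Valued.v : Valuation (PadicAlgCl ℓ) NNReal).valuationSubring a)) ^ n) → ∃ π : Literature.NumberTheory.Automorphic.CuspidalAutomorphicRepData n K hcpt, π.1.IsLAlgebraic ∧ ∀ᶠ v : IsDedekindDomain.HeightOneSpectrum (NumberField.RingOfIntegers K) in cofinite, ρ.IsUnramifiedAt v ∧ (∃ α : Multiset ℂ, π.1.HasSatakeParamAt v α) ∧ ∀ α : Multiset ℂ, π.1.HasSatakeParamAt v α → ∃ P Q : Polynomial (Valued.v : Valuation (PadicAlgCl ℓ) NNReal).valuationSubring, ρ.HasFrobCharpolyAt v (P.map (Valued.v : Valuation (PadicAlgCl ℓ) NNReal).valuationSubring.subtype) ∧ Literature.NumberTheory.Automorphic.arithFrobPolyOfSatake ι v.residueCard 1 α = Q.map (Valued.v : Valuation (PadicAlgCl ℓ) NNReal).valuationSubring.subtype ∧ P.map (IsLocalRing.residue (Valued.v : Valuation (PadicAlgCl ℓ) NNReal).valuationSubring) = Q.map (IsLocalRing.residue (Valued.v : Valuation (PadicAlgCl ℓ) NNReal).valuationSubring)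

/-- item stmt-Langlands-28874 · crux · rank 7 · open · by planner
why it might fail: Serre-type residual automorphy outside the Odlyzko-bounded world (large root discriminant): no finiteness-of-fields leverage, open in every rank ≥ 2 over general K.
sources: Summit.Langlands.Langlands.Theses.OdlyzkoWorldSplit.TransOdlyzkoAutomorphy (stmt-Langlands-28874)
[crux] (RES, the ASYMPTOTIC REGIME — declared RESIDUAL of the node; G7 hypothesis form) given OW:
for every number field K, n ≥ 1, prime ℓ, ι : ℚ̄_ℓ ≃ ℂ and every irreducible pinned-geometric ℓ-adic
ρ : Γ_K → GL_n(ℚ̄_ℓ) that is NOT in the Odlyzko world (no number field L ⊇ K with rd(L) < Ω(L)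
splits ℙρ̄^ss), ρ is residually automorphic: some L-algebraic cuspidal π of GL_n(𝔸_K) has
L-normalised Satake polynomials congruent mod 𝔪_ℓ to the Frobenius polynomials of ρ at almost all
places. [deps: OdlyzkoWorldAutomorphy] [difficulty: open-problem] TAGS (crit-1 CLEARED
2026-08-30T05:29:08Z STATUS L211, CRITIC-LEDGER row 50; REV 2 ERRATUM (Galois witness field) NODE
L221, CLEARED 05:41:20Z L222, row 53; census v6): RES NEW = the declared RESIDUAL of the lens-5-g3
lineage (D-0179) · ASYMPTOTIC REGIME (rd ≥ Ω over every finite extension) · hypothesis form OW →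
(Serre_w outside the world) (census rule G7) · WEAKER (kernel `res_of_serre`; probe RES ⇏ Serre_w
FAIL; BC7 CLEAN) · OPEN · leaf IDEA-NEEDED / BARRIER: no discriminant method reaches it
(Golod–Shafarevich infinite class field towers, not catalogued by name — «no catalogued barrier»;
inside `TaylorWilesNumericalCoincidence_holds` / `Shi -/
@[route_item "route-Langlands-LieDefectSplit", crux]
def TransOdlyzkoAutomorphy : Prop :=
  OdlyzkoWorldAutomorphy → ∀ (K : Type) [Field K] [NumberField K] (n : ℕ) (hcpt : Literature.NumberTheory.Automorphic.isCompact_glFiniteIntegralLevel n K), 0 < n → ∀ (ℓ : ℕ) [Fact ℓ.Prime] (ι : PadicAlgCl ℓ ≃+* ℂ) (ρ : Literature.NumberTheory.GaloisRepresentations.FramedGaloisRep K (PadicAlgCl ℓ) n), ρ.toGaloisRep.IsIrreducible → ((∀ᶠ v : IsDedekindDomain.HeightOneSpectrum (NumberField.RingOfIntegers K) in cofinite, ρ.IsUnramifiedAt v) ∧ ∀ (v : IsDedekindDomain.HeightOneSpectrum (NumberField.RingOfIntegers K)) (hv : ((ℓ : ℕ) : NumberField.RingOfIntegers K) ∈ v.asIdeal),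 (Literature.NumberTheory.PAdicHodge.fontainePstAdicCompletion v ℓ hv).IsDeRhamFramed (ρ.toLocal v)) → ¬ (∃ (L : Type) (_ : Field L) (_ : NumberField L) (_ : Algebra K L), IsGalois K L ∧ (|(NumberField.discr L : ℝ)|) ^ ((1 : ℝ) / (Module.finrank ℚ L : ℝ)) < 4 * Real.pi * Real.exp (Real.eulerMascheroniConstant + (NumberField.InfinitePlace.nrRealPlaces L : ℝ) / (Module.finrank ℚ L : ℝ)) ∧ ∀ᶠ w : IsDedekindDomain.HeightOneSpectrum (NumberField.RingOfIntegers L) in cofinite, ∃ (P : Polynomial (Valued.v : Valuation (PadicAlgCl ℓ) NNReal).valuationSubring) (a : (Valued.v : Valuation (PadicAlgCl ℓ) NNReal).valuationSubring), (ρ.restrictField L).HasFrobCharpolyAt w (P.map (Valued.v : Valuation (PadicAlgCl ℓ) NNReal).valuationSubring.subtype) ∧ P.map (IsLocalRing.residue (Valued.v : Valuation (PadicAlgCl ℓ) NNReal).valuationSubring) = (Polynomial.X - Polynomial.C (IsLocalRing.residue (Valued.v : Valuation (PadicAlgCl ℓ) NNReal).valuationSubring a)) ^ n) → ∃ π : Literature.NumberTheory.Automorphic.CuspidalAutomorphicRepData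 n K hcpt, π.1.IsLAlgebraic ∧ ∀ᶠ v : IsDedekindDomain.HeightOneSpectrum (NumberField.RingOfIntegers K) in cofinite, ρ.IsUnramifiedAt v ∧ (∃ α : Multiset ℂ, π.1.HasSatakeParamAt v α) ∧ ∀ α : Multiset ℂ, π.1.HasSatakeParamAt v α → ∃ P Q : Polynomial (Valued.v : Valuation (PadicAlgCl ℓ) NNReal).valuationSubring, ρ.HasFrobCharpolyAt v (P.map (Valued.v : Valuation (PadicAlgCl ℓ) NNReal).valuationSubring.subtype) ∧ Literature.NumberTheory.Automorphic.arithFrobPolyOfSatake ι v.residueCard 1 α = Q.map (Valued.v : Valuation (PadicAlgCl ℓ) NNReal).valuationSubring.subtype ∧ P.map (IsLocalRing.residue (Valued.v : Valuation (PadicAlgCl ℓ) NNReal).valuationSubring) = Q.map (IsLocalRing.residue (Valued.v : Valuation (PadicAlgCl ℓ) NNReal).valuationSubring)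

/-- item stmt-Langlands-27679 · support · rank 9 · open · by planner
sources: Summit.Langlands.Langlands.Theses.BrightMateBypass.SolvableAscentConstituent (stmt-Langlands-27679), ArthurClozel1989 [corpus:book:ArthurClozelAMS120 Ch. 3 Thm 4.2 / Thm 5.1 / §6 (bib ArthurClozel1989)]
[support] AUT↑ — SOLVABLE GALOIS ASCENT OF WEAK AUTOMORPHY TO A CONSTITUENT (NEW; PRINT given W⁺,
whose host text is the antecedent verbatim): for ρ : Γ_M → GL_n(ℚ̄_ℓ) irreducible and weakly
automorphic over M (for every level structure a cuspidal L-algebraic π on GL_n/M, Satake–Frobenius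
compatible a.e.) and N/M finite solvable Galois, SOME irreducible constituent ϑ of ρ|N (trace form
tr ρ|N = tr ϑ + tr ϑᶜ, rank m ≥ 1) is weakly automorphic over N. Print: base change of π along the
cyclic prime-degree layers of N/M (Arthur–Clozel Ch. 3 Thm 4.2 / Thm 5.1: at each layer cuspidal or
an isobaric orbit sum σ ⊞ σ^τ ⊞ …, pass to σ; L-algebraicity is inherited by the archimedean
sub-parameters), Clifford (ρ|N semisimple with Gal(N/M)-conjugate constituents), identification of
the cuspidal constituent reached with one Galois constituent via the W⁺ avatars + Chebotarev +
Brauer–Nesbitt. Same currency as the tree items HolomorphicLimitSplit.SolvableGaloisAscent /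
CliffordSolvableDescent (support, PRINT mod W⁺). -/
@[route_item "route-Langlands-LieDefectSplit", crux]
def SolvableAscentConstituent : Prop :=
  (∀ (K : Type) [Field K] [NumberField K] (n : ℕ) (hcpt : Literature.NumberTheory.Automorphic.isCompact_glFiniteIntegralLevel n K), 0 < n → ∀ (π : Literature.NumberTheory.Automorphic.CuspidalAutomorphicRepData n K hcpt), π.1.IsLAlgebraic → ∀ (ℓ : ℕ) [Fact ℓ.Prime] (ι : PadicAlgCl ℓ ≃+* ℂ), ∃ ρ : Literature.NumberTheory.GaloisRepresentations.FramedGaloisRep K (PadicAlgCl ℓ) n, ρ.toGaloisRep.IsIrreducible ∧ ∀ᶠ v : IsDedekindDomain.HeightOneSpectrum (NumberField.RingOfIntegers K) in cofinite, SatakeFrobCompatibleAt ι π.1 ρ v) → ∀ (M : Type) [Field M] [NumberField M] (n : ℕ) (ℓ : ℕ) [Fact ℓ.Prime] (ι : PadicAlgCl ℓ ≃+* ℂ) (ρ : Literature.NumberTheory.GaloisRepresentations.FramedGaloisRep M (PadicAlgCl ℓ) n), ρ.toGaloisRep.IsIrreducible → 0 < n → (∀ hcpt : Literature.NumberTheory.Automorphic.isCompact_glFiniteIntegralLevel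 n M, ∃ π : Literature.NumberTheory.Automorphic.CuspidalAutomorphicRepData n M hcpt, π.1.IsLAlgebraic ∧ ∀ᶠ v : IsDedekindDomain.HeightOneSpectrum (NumberField.RingOfIntegers M) in Filter.cofinite, SatakeFrobCompatibleAt ι π.1 ρ v) → ∀ (N : Type) [Field N] [NumberField N] [Algebra M N], IsGalois M N → IsSolvable (N ≃ₐ[M] N) → ∃ (m : ℕ) (ϑ : Literature.NumberTheory.GaloisRepresentations.FramedGaloisRep N (PadicAlgCl ℓ) m), ϑ.toGaloisRep.IsIrreducible ∧ (∃ (mc : ℕ) (θc : Literature.NumberTheory.GaloisRepresentations.FramedGaloisRep N (PadicAlgCl ℓ) mc), ∀ g : Field.absoluteGaloisGroup N, Literature.NumberTheory.GaloisRepresentations.FramedRep.trace (ρ.restrictField N) g = Literature.NumberTheory.GaloisRepresentations.FramedRep.trace ϑ g + Literature.NumberTheory.GaloisRepresentations.FramedRep.trace θc g) ∧ 0 < m ∧ ∀ hcptN : Literature.NumberTheory.Automorphic.isCompact_glFiniteIntegralLevel m N, ∃ π : Literature.NumberTheory.Automorphic.CuspidalAutomorphicRepData m N hcptN, π.1.IsLAlgebraic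 ∧ ∀ᶠ v : IsDedekindDomain.HeightOneSpectrum (NumberField.RingOfIntegers N) in Filter.cofinite, SatakeFrobCompatibleAt ι π.1 ϑ v

/-- item stmt-Langlands-28418 · support · rank 9 · open · by planner
sources: Summit.Langlands.Langlands.Theses.CoreAdequacySplit.closes (rev 1 @24edb36ac99c; statements = rev 0 @9eafc6ebdcd4), Summit.Langlands.Langlands.Theses.CoreAdequacySplit.NoAdequateLayerLifting (stmt-Langlands-27954)
[support] FRAME′ (content = the PARENT ROUTE route-Langlands-CoreAdequacySplit rev 1 @24edb36ac99c
(= rev 0 up to prose) VERBATIM with RSL abstracted): `CoreAdequacySplit.NoAdequateLayerLifting →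
Langlands`, i.e. the ten other binders of `CoreAdequacySplit.closes` (AIL 27953, W⁺ 17415, AUT↑
27679, CSD 31695, TRANS 27955, FRAME 27956, OW 28903, RES 28874, BRIGHT 27678, A† 33906) — node
kernel `frame_of_parent`. Never staffed on its own: it closes when the parent's other items close.
Refines-tag: this route refines route-Langlands-CoreAdequacySplit:NoAdequateLayerLifting
(stmt-Langlands-27954), used BY NAME here. -/
@[route_item "route-Langlands-LieDefectSplit", crux]
def NoAdequateLayerFrame : Prop :=
  Summit.Langlands.Langlands.Theses.CoreAdequacySplit.NoAdequateLayerLifting → _root_.Langlands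

/-- item stmt-Langlands-31695 · support · rank 9 · open · by planner
sources: Summit.Langlands.Langlands.Theses.HolomorphicLimitSplit.CliffordSolvableDescent (Theses/HolomorphicLimitSplit.lean :804), ArthurClozelAMS120 Ch. 3 Thm 4.2 (ii), Thm 6.2 [corpus:book:ArthurClozelAMS120 Ch. 3 Thm 4.2 / Thm 5.1 / §6 (bib ArthurClozel1989)]
[support] [support] S2 — CLIFFORD SOLVABLE DESCENT (PRINT given W⁺, inlined; Langlands-implied,
kernel `cliffordSolvableDescent_of_weak`; generalises SolvableDescent 29341, which assumed ρ|E
irreducible): ρ irreducible geometric over K of rank n ≥ 1, E/K solvable Galois, ONE irreducible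
constituent ϑ of ρ|E of rank ≥ 1 weakly automorphic over E ⇒ ρ weakly automorphic over K. Proof in
print along cyclic prime layers K_i ⊂ K_{i+1}, top down: the constituents of ρ|E are
Gal(E/K)-conjugate (Clifford; conjugates of automorphic are automorphic); Clifford dichotomy
(`CliffordInducedPrimeIndex`): θ_i|K_{i+1} irreducible ⇒ its cuspidal Π is σ-invariant by strong
multiplicity one ⇒ Π = BC(π) (Arthur–Clozel III.4.2(b)), and ρ_π (W⁺ over K_i) ≅ θ_i ⊗ η^j for a
character η of the layer, so θ_i ↔ π ⊗ η^{-j}; θ_i|K_{i+1} reducible ⇒ θ_i = Ind θ_{i+1} ↔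
automorphic induction AI(Π), cuspidal as Π ≄ Π^σ (AC III.6, Henniart 2012); L-algebraicity
preserved. [difficulty: L] [difficulty: L] [TAGS: RESIDUAL MODE node lens-3-g7 WeilRestrictionSplit
(bus L405; sibling root-level route over the N0 PrimeSwitchSplit frame re-cutting B_w =
WeakGeometricAutomorphy stmt-Langlands-17414), crit-1 CLEARED 2026-08-3 -/
@[route_item "route-Langlands-LieDefectSplit", crux]
def CliffordSolvableDescent : Prop :=
  (∀ (K : Type) [Field K] [NumberField K] (n : ℕ) (hcpt : Literature.NumberTheory.Automorphic.isCompact_glFiniteIntegralLevel n K), 0 < n → ∀ (π : Literature.NumberTheory.Automorphic.CuspidalAutomorphicRepData n K hcpt), π.1.IsLAlgebraic → ∀ (ℓ : ℕ) [Fact ℓ.Prime] (ι : PadicAlgCl ℓ ≃+* ℂ), ∃ ρ : Literature.NumberTheory.GaloisRepresentations.FramedGaloisRep K (PadicAlgCl ℓ) n, ρ.toGaloisRep.IsIrreducible ∧ ∀ᶠ v : IsDedekindDomain.HeightOneSpectrum (NumberField.RingOfIntegers K) in Filter.cofinite, SatakeFrobCompatibleAt ι π.1 ρ v) → ∀ (K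 : Type) [Field K] [NumberField K] (n : ℕ) (ℓ : ℕ) [Fact ℓ.Prime] (ι : PadicAlgCl ℓ ≃+* ℂ) (ρ : Literature.NumberTheory.GaloisRepresentations.FramedGaloisRep K (PadicAlgCl ℓ) n), ρ.toGaloisRep.IsIrreducible → ((∀ᶠ v : IsDedekindDomain.HeightOneSpectrum (NumberField.RingOfIntegers K) in Filter.cofinite, ρ.IsUnramifiedAt v) ∧ ∀ (v : IsDedekindDomain.HeightOneSpectrum (NumberField.RingOfIntegers K)) (hv : ((ℓ : ℕ) : NumberField.RingOfIntegers K) ∈ v.asIdeal), (Literature.NumberTheory.PAdicHodge.fontainePstAdicCompletion v ℓ hv).IsDeRhamFramed (ρ.toLocal v)) → 0 < n → ∀ (E : Type) [Field E] [NumberField E] [Algebra K E], IsGalois K E → IsSolvable (E ≃ₐ[K] E) → ∀ (m : ℕ) (ϑ : Literature.NumberTheory.GaloisRepresentations.FramedGaloisRep E (PadicAlgCl ℓ) m), ϑ.toGaloisRep.IsIrreducible → (∃ (mc : ℕ) (θc : Literature.NumberTheory.GaloisRepresentations.FramedGaloisRep E (PadicAlgCl ℓ) mc), ∀ g : Field.absoluteGaloisGroup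 E, Literature.NumberTheory.GaloisRepresentations.FramedRep.trace (ρ.restrictField E) g = Literature.NumberTheory.GaloisRepresentations.FramedRep.trace ϑ g + Literature.NumberTheory.GaloisRepresentations.FramedRep.trace θc g) → 0 < m → (∀ hcptE : Literature.NumberTheory.Automorphic.isCompact_glFiniteIntegralLevel m E, ∃ π : Literature.NumberTheory.Automorphic.CuspidalAutomorphicRepData m E hcptE, π.1.IsLAlgebraic ∧ ∀ᶠ v : IsDedekindDomain.HeightOneSpectrum (NumberField.RingOfIntegers E) in Filter.cofinite, SatakeFrobCompatibleAt ι π.1 ϑ v) → ∀ hcpt : Literature.NumberTheory.Automorphic.isCompact_glFiniteIntegralLevel n K, ∃ π : Literature.NumberTheory.Automorphic.CuspidalAutomorphicRepData n K hcpt, π.1.IsLAlgebraic ∧ ∀ᶠ v : IsDedekindDomain.HeightOneSpectrum (NumberField.RingOfIntegers K) in Filter.cofinite, SatakeFrobCompatibleAt ι π.1 ρ v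

/-- item stmt-Langlands-27955 · support · rank 9 · open · by planner
sources: BLGGT2014 p25 citing BLGHT Lemma 1.4 [corpus:paper:arxiv-1010.2561 p25 (Lemma 1.4 of BLGHT: soluble base change)], BLGG2013 App. A Lemma 6.1.3 [corpus:paper:arxiv-1106.5586 p21 (App. A: Lemma 6.1.3/A.1.3 normal subgroup of prime-to-ℓ index; Prop 6.2.1/A.2.1 adequacy for GL₂)], ArthurClozel1989 [corpus:book:ArthurClozelAMS120 Ch. 3 Thm 4.2 / Thm 5.1 / §6 (bib ArthurClozel1989)], Summit.Langlands.Langlands.Theses.BrightMateBypass.SolvableAscentConstituent / HolomorphicLimitSplit.CliffordSolvableDescent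
[support] TRANS — SOLVABLE ADEQUACY TRANSPORT (NEW; PRINT given its antecedents, all items of this
route BY NAME): W⁺ → AUT↑ → CSD → AIL → SBL, where SBL = F† on the BRIDGE box «image not adequate,
but some J between the perfect core and the image is adequate-irreducible». Proof in print: G =
Gal(K(ρ̄,ζ_ℓ)/K), R its perfect core, I = ρ̄(Γ_{K(ζ_ℓ)}) with perfect core P = ρ̄(R); given J, put B
= {g ∈ Gal(K(ρ̄,ζ_ℓ)/K(ζ_ℓ)) : ρ̄(g) ∈ J} ⊇ R, N = fixed field of R (solvable Galois over K), M =
fixed field of B ⊆ N, so ρ̄(Γ_{M(ζ_ℓ)}) = J and N/M is solvable Galois; the link antecedent (π, ρ')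
over K ascends to N (AUT↑) and descends to M (CSD for ρ'|M, irreducible since J is); every other
hypothesis of F† restricts to M (IH is field-uniform, ℓ < 2(n+1) unchanged, geometric clauses
restrict, ρ|M residually ⊇ J absolutely irreducible); AIL over M gives π_M (at every level
structure: hcpt is a proof of a Prop); AUT↑ (N/M) and CSD (N/K; ρ irreducible over K is F†'s
hypothesis) return to K. -/
@[route_item "route-Langlands-LieDefectSplit", crux]
def SolvableAdequacyTransport : Prop :=
  SatakeAvatarExistence → SolvableAscentConstituent → CliffordSolvableDescent → AdequateImageLifting → ∀ (K : Type) [Field K] [NumberField K] (n : ℕ) (hcpt : Literature.NumberTheory.Automorphic.isCompact_glFiniteIntegralLevel n K), 0 < n → (∀ m : ℕ, m < n → ∀ (K : Type) [Field K] [NumberField K] (hcpt : Literature.NumberTheory.Automorphic.isCompact_glFiniteIntegralLevel m K), 0 < m → ∀ (ℓ : ℕ) [Fact ℓ.Prime] (ι : PadicAlgCl ℓ ≃+* ℂ) (ρ : Literature.NumberTheory.GaloisRepresentations.FramedGaloisRep K (PadicAlgCl ℓ) m), ρ.toGaloisRep.IsIrreducible → ((∀ᶠ v : IsDedekindDomain.HeightOneSpectrum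 (NumberField.RingOfIntegers K) in cofinite, ρ.IsUnramifiedAt v) ∧ ∀ (v : IsDedekindDomain.HeightOneSpectrum (NumberField.RingOfIntegers K)) (hv : ((ℓ : ℕ) : NumberField.RingOfIntegers K) ∈ v.asIdeal), (Literature.NumberTheory.PAdicHodge.fontainePstAdicCompletion v ℓ hv).IsDeRhamFramed (ρ.toLocal v)) → (∃ (π : Literature.NumberTheory.Automorphic.CuspidalAutomorphicRepData m K hcpt) (ρ' : Literature.NumberTheory.GaloisRepresentations.FramedGaloisRep K (PadicAlgCl ℓ) m), π.1.IsLAlgebraic ∧ ρ'.toGaloisRep.IsIrreducible ∧ (∀ᶠ v : IsDedekindDomain.HeightOneSpectrum (NumberField.RingOfIntegers K) in cofinite, SatakeFrobCompatibleAt ι π.1 ρ' v) ∧ ∀ᶠ v : IsDedekindDomain.HeightOneSpectrum (NumberField.RingOfIntegers K) in cofinite, ∃ P P' : Polynomial (Valued.v : Valuation (PadicAlgCl ℓ) NNReal).valuationSubring, ρ.HasFrobCharpolyAt v (P.map (Valued.v : Valuation (PadicAlgCl ℓ) NNReal).valuationSubring.subtype) ∧ ρ'.HasFrobCharpolyAt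 v (P'.map (Valued.v : Valuation (PadicAlgCl ℓ) NNReal).valuationSubring.subtype) ∧ P.map (IsLocalRing.residue (Valued.v : Valuation (PadicAlgCl ℓ) NNReal).valuationSubring) = P'.map (IsLocalRing.residue (Valued.v : Valuation (PadicAlgCl ℓ) NNReal).valuationSubring)) → ∃ π : Literature.NumberTheory.Automorphic.CuspidalAutomorphicRepData m K hcpt, π.1.IsLAlgebraic ∧ ∀ᶠ v : IsDedekindDomain.HeightOneSpectrum (NumberField.RingOfIntegers K) in cofinite, SatakeFrobCompatibleAt ι π.1 ρ v) → ∀ (ℓ : ℕ) [Fact ℓ.Prime] (ι : PadicAlgCl ℓ ≃+* ℂ) (ρ : Literature.NumberTheory.GaloisRepresentations.FramedGaloisRep K (PadicAlgCl ℓ) n), ℓ < 2 * (n + 1) → (ρ.restrictField (CyclotomicField ℓ K)).IsResiduallyAbsIrreducible → ¬ (∃ τ : Field.absoluteGaloisGroup (CyclotomicField ℓ K) →* Matrix.GeneralLinearGroup (Fin n) (Literature.NumberTheory.GaloisRepresentations.padicAlgClResidueField ℓ), (ρ.restrictField (CyclotomicField ℓ K)).IsReductionOf (RingHom.id (Literature.NumberTheory.GaloisRepresentations.padicAlgClResidueField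 ℓ)) τ ∧ Literature.NumberTheory.GaloisRepresentations.IsAbsIrreducible τ ∧ Literature.NumberTheory.GaloisRepresentations.Subgroup.IsThorneAdequate τ.range) → (∃ τ : Field.absoluteGaloisGroup (CyclotomicField ℓ K) →* Matrix.GeneralLinearGroup (Fin n) (Literature.NumberTheory.GaloisRepresentations.padicAlgClResidueField ℓ), (ρ.restrictField (CyclotomicField ℓ K)).IsReductionOf (RingHom.id (Literature.NumberTheory.GaloisRepresentations.padicAlgClResidueField ℓ)) τ ∧ Literature.NumberTheory.GaloisRepresentations.IsAbsIrreducible τ ∧ ∃ P J : Subgroup (Matrix.GeneralLinearGroup (Fin n) (Literature.NumberTheory.GaloisRepresentations.padicAlgClResidueField ℓ)), (P ≤ τ.range ∧ ⁅P, P⁆ = P ∧ ∀ Q : Subgroup (Matrix.GeneralLinearGroup (Fin n) (Literature.NumberTheory.GaloisRepresentations.padicAlgClResidueField ℓ)), Q ≤ τ.range → ⁅Q, Q⁆ = Q → Q ≤ P) ∧ P ≤ J ∧ J ≤ τ.range ∧ Literature.NumberTheory.GaloisRepresentations.IsAbsIrreducible J.subtype ∧ Literature.NumberTheory.GaloisRepresentations.Subgroup.IsThorneAdequate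 J) → ρ.toGaloisRep.IsIrreducible → ((∀ᶠ v : IsDedekindDomain.HeightOneSpectrum (NumberField.RingOfIntegers K) in cofinite, ρ.IsUnramifiedAt v) ∧ ∀ (v : IsDedekindDomain.HeightOneSpectrum (NumberField.RingOfIntegers K)) (hv : ((ℓ : ℕ) : NumberField.RingOfIntegers K) ∈ v.asIdeal), (Literature.NumberTheory.PAdicHodge.fontainePstAdicCompletion v ℓ hv).IsDeRhamFramed (ρ.toLocal v)) → (∃ (π : Literature.NumberTheory.Automorphic.CuspidalAutomorphicRepData n K hcpt) (ρ' : Literature.NumberTheory.GaloisRepresentations.FramedGaloisRep K (PadicAlgCl ℓ) n), π.1.IsLAlgebraic ∧ ρ'.toGaloisRep.IsIrreducible ∧ (∀ᶠ v : IsDedekindDomain.HeightOneSpectrum (NumberField.RingOfIntegers K) in cofinite, SatakeFrobCompatibleAt ι π.1 ρ' v) ∧ ∀ᶠ v : IsDedekindDomain.HeightOneSpectrum (NumberField.RingOfIntegers K) in cofinite, ∃ P P' : Polynomial (Valued.v : Valuation (PadicAlgCl ℓ) NNReal).valuationSubring, ρ.HasFrobCharpolyAt v (P.map (Valued.v : Valuation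 (PadicAlgCl ℓ) NNReal).valuationSubring.subtype) ∧ ρ'.HasFrobCharpolyAt v (P'.map (Valued.v : Valuation (PadicAlgCl ℓ) NNReal).valuationSubring.subtype) ∧ P.map (IsLocalRing.residue (Valued.v : Valuation (PadicAlgCl ℓ) NNReal).valuationSubring) = P'.map (IsLocalRing.residue (Valued.v : Valuation (PadicAlgCl ℓ) NNReal).valuationSubring)) → ∃ π : Literature.NumberTheory.Automorphic.CuspidalAutomorphicRepData n K hcpt, π.1.IsLAlgebraic ∧ ∀ᶠ v : IsDedekindDomain.HeightOneSpectrum (NumberField.RingOfIntegers K) in cofinite, SatakeFrobCompatibleAt ι π.1 ρ v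

/-- item stmt-Langlands-28417 · support · rank 9 · open · by planner
sources: decomp-langlands critic CLEARED row 189 (F2) 2026-08-30 (R1 notice of record: the downward solvable-descent shadow D↓; HOME/STATUS.md L965; verdicts/verdict189.txt), ArthurClozel1989 [corpus:book:ArthurClozelAMS120 Ch. 3 Thm 4.2 / Thm 5.1 / §6 (bib ArthurClozel1989): cyclic prime-degree base change and descent for GL(n), solvable by iteration], BLGGT2014 p25 citing BLGHT Lemma 1.4 [corpus:paper:arxiv-1010.2561 p25 (Lemma 1.4 of BLGHT: soluble base change)], Summit.Langlands.Langlands.Theses.CoreAdequacySplit.SolvableAdequacyTransport (stmt-Langlands-27955; the UPWARD bridge this item mirrors), Summit.Langlands.Langlands.Theses.BrightMateBypass.SolvableAscentConstituent (27679) / HolomorphicLimitSplit.CliffordSolvableDescent (31695), Summit.Langlands.Langlands.Theorems.BaseFieldAscentReciprocityTRCMPotentialAutomorphyCMTightness.exists_restrictField_self_eq_conj (landed: restriction along K/K is a conjugate)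
[support] TRANS↓ — SOLVABLE DESCENT TRANSPORT (NEW; PRINT modulo the parent's kit, all antecedents
items of this route BY NAME; Langlands-implied — `Cert.transport_of_langlands`): OW → RES → W⁺ →
AUT↑ → CSD → AIL → TRANS → SBL↓, where SBL↓ `DescentShadowLifting` = RSL on the R1 carve D↓ (critic
row 189 (F2)): ρ ≅ ρ₀|_{Γ_K} ⊗ χ in the trace currency (∀ g, tr ρ(g) = tr χ(g) · tr ρ₀|_K(g)) with
K/K₀ finite solvable Galois, ρ₀ irreducible, geometric, ρ̄₀|Γ_{K₀(ζ_ℓ)} absolutely irreducible with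
ADQ ∨ SADQ over K₀, χ a geometric ℓ-adic character of Γ_K. CHAIN (node docstring «THE CARVE IN
DETAIL»): (1) Serre_w(ρ₀) at every level hcpt₀ from OW ∧ RES (same n, same ℓ); (2) the W⁺-avatar of
that π₀ links ρ₀ (trace identity ⇒ equal Frobenius polynomials a.e.); (3) LiftTail(ρ₀) from AIL (ADQ
ρ₀) or from TRANS (SADQ ρ₀ ∧ ¬ADQ ρ₀; TRANS consumes W⁺, AUT↑, CSD, AIL) with the instance's IH
(`LiftBelow n` is field-uniform) ⇒ ρ₀ weakly automorphic at every level; (4) AUT↑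
`SolvableAscentConstituent` along the solvable Galois K/K₀ (Arthur–Clozel cyclic prime layers
[corpus:book:ArthurClozelAMS120 Ch. 3 Thm 4.2 / Thm 5.1 / §6 (bib ArthurClozel1989): cyclic
prime-degree base change and descent for GL(n -/
@[route_item "route-Langlands-LieDefectSplit", crux]
def SolvableDescentTransport : Prop :=
  OdlyzkoWorldAutomorphy → TransOdlyzkoAutomorphy → SatakeAvatarExistence → SolvableAscentConstituent → CliffordSolvableDescent → AdequateImageLifting → SolvableAdequacyTransport → ∀ (K : Type) [Field K] [NumberField K] (n : ℕ) (hcpt : Literature.NumberTheory.Automorphic.isCompact_glFiniteIntegralLevel n K), 0 < n → Summit.Langlands.Langlands.Theorems.CoreAdequacy.LiftBelow n → ∀ (ℓ : ℕ) [Fact ℓ.Prime] (ι : PadicAlgCl ℓ ≃+* ℂ) (ρ : Literature.NumberTheory.GaloisRepresentations.FramedGaloisRep K (PadicAlgCl ℓ) n), ℓ < 2 * (n + 1) → Summit.Langlands.Langlands.Theorems.CoreAdequacy.CycIrr ρ → ¬ Summit.Langlands.Langlands.Theorems.CoreAdequacy.AdequateCyclotomicImage ρ → ¬ Summit.Langlands.Langlands.Theorems.CoreAdequacy.SolvablyAdequateImage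 ρ → (∃ (K₀ : Type) (_ : Field K₀) (_ : NumberField K₀) (_ : Algebra K₀ K), IsGalois K₀ K ∧ IsSolvable (K ≃ₐ[K₀] K) ∧ ∃ (ρ₀ : Literature.NumberTheory.GaloisRepresentations.FramedGaloisRep K₀ (PadicAlgCl ℓ) n) (χ : Literature.NumberTheory.GaloisRepresentations.FramedGaloisRep K (PadicAlgCl ℓ) 1), ρ₀.toGaloisRep.IsIrreducible ∧ ((∀ᶠ v : IsDedekindDomain.HeightOneSpectrum (NumberField.RingOfIntegers K₀) in cofinite, ρ₀.IsUnramifiedAt v) ∧ ∀ (v : IsDedekindDomain.HeightOneSpectrum (NumberField.RingOfIntegers K₀)) (hv : ((ℓ : ℕ) : NumberField.RingOfIntegers K₀) ∈ v.asIdeal), (Literature.NumberTheory.PAdicHodge.fontainePstAdicCompletion v ℓ hv).IsDeRhamFramed (ρ₀.toLocal v)) ∧ ((∀ᶠ v : IsDedekindDomain.HeightOneSpectrum (NumberField.RingOfIntegers K) in cofinite, χ.IsUnramifiedAt v) ∧ ∀ (v : IsDedekindDomain.HeightOneSpectrum (NumberField.RingOfIntegers K)) (hv : ((ℓ : ℕ)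 : NumberField.RingOfIntegers K) ∈ v.asIdeal), (Literature.NumberTheory.PAdicHodge.fontainePstAdicCompletion v ℓ hv).IsDeRhamFramed (χ.toLocal v)) ∧ Summit.Langlands.Langlands.Theorems.CoreAdequacy.CycIrr ρ₀ ∧ (Summit.Langlands.Langlands.Theorems.CoreAdequacy.AdequateCyclotomicImage ρ₀ ∨ Summit.Langlands.Langlands.Theorems.CoreAdequacy.SolvablyAdequateImage ρ₀) ∧ ∀ g : Field.absoluteGaloisGroup K, Literature.NumberTheory.GaloisRepresentations.FramedRep.trace ρ g = Literature.NumberTheory.GaloisRepresentations.FramedRep.trace χ g * Literature.NumberTheory.GaloisRepresentations.FramedRep.trace (ρ₀.restrictField K) g) → ¬ Summit.Langlands.Langlands.Theorems.BrightMate.SolvablyReducible ρ → ¬ Summit.Langlands.Langlands.Theorems.BrightMate.SolvablyMated ι ρ → Summit.Langlands.Langlands.Theorems.CoreAdequacy.LiftTail K n hcpt ℓ ι ρ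

/-- item stmt-Langlands-28419 · assembly · rank 1 · closed · proved by Summit.Langlands.Langlands.Theorems.lieDefectSplit_assembly_proof (prover) · by planner
sources: node LieDefectSplit.lean `closes_framed`, `LieDefectInline.closes_inline`, `assembly_holds`, `rsl_iff_cells`
[assembly] the curried form of `closes`: FRAME′ applied to RSL, obtained instance-wise by TWO
excluded middles — on the carve D↓ (D↓ ⇒ TRANS↓ fed with OW, RES, W⁺, AUT↑, CSD, AIL, TRANS) and on
the dial SQAL (SQAL ⇒ LIE, ¬SQAL ⇒ DEG); the literal texts are read off the cells' hypotheses by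
unification. PROVED outright in the node (`LieDefectInline.assembly_holds`, axioms standard). -/
@[route_item "route-Langlands-LieDefectSplit"]
def Assembly : Prop :=
  LieObstructedLifting → DegenerateLayerLifting → SolvableDescentTransport → OdlyzkoWorldAutomorphy → TransOdlyzkoAutomorphy → SatakeAvatarExistence → SolvableAscentConstituent → CliffordSolvableDescent → AdequateImageLifting → SolvableAdequacyTransport → NoAdequateLayerFrame → _root_.Langlands

-- `Assembly` holds: proved by `Summit.Langlands.Langlands.Theorems.lieDefectSplit_assembly_proof` (its module imports this route file, so no `_holds` link can be stated here).

/-! D-0027 §2.1 — DECIDING THEOREM (planner-authored via `route open/edit --closes-file`; by planner-decomp-langlands-writer-1-g5-0 2026-08-30T21:05:57Z):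
its hypotheses are this route's items and its conclusion the sub-problem Statement (glue_lint), and it elaborates with this file. -/

/-- DECIDING THEOREM of the child route `LieDefectSplit` v2 (lens-5 g12; refines `CoreAdequacySplit.NoAdequateLayerLifting` stmt-Langlands-27954):
eleven load-bearing binders LIE → DEG → TRANS↓ → OW → RES → W⁺ → AUT↑ → CSD → AIL → TRANS → FRAME′ → Langlands.  RSL from the three cells by TWO
excluded middles — on the R1 carve D↓ (fed to TRANS↓ with the parent's seven kit binders) and on the dial SQAL (LIE / DEG); the literal texts are
inferred from the cells' hypotheses by unification (node KERNEL `rsl_of_cells`, `shadow_of_transport`) — then FRAME′ (= the parent route below RSL).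
Pure logic; the cells are structured over `Theorems.CoreAdequacy` / `Theorems.BrightMate` BY NAME and agree with RSL's inline text definitionally. -/
@[closes "route-Langlands-LieDefectSplit"] theorem closes
    (hL : LieObstructedLifting) (hD : DegenerateLayerLifting) (hTd : SolvableDescentTransport)
    (hOW : OdlyzkoWorldAutomorphy) (hRES : TransOdlyzkoAutomorphy) (hW : SatakeAvatarExistence) (hUp : SolvableAscentConstituent)
    (hDown : CliffordSolvableDescent) (h₁ : AdequateImageLifting) (hT : SolvableAdequacyTransport) (hF : NoAdequateLayerFrame) : _root_.Langlands := by
  refine hF ?_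
  intro K _ _ n hcpt hn ih ℓ _ ι ρ hlt hc hAdq hS
  exact (Classical.em _).elim (fun hDs => hTd hOW hRES hW hUp hDown h₁ hT K n hcpt hn ih ℓ ι ρ hlt hc hAdq hS hDs) fun hDs =>
    (Classical.em _).elim (fun hQ => hL K n hcpt hn ih ℓ ι ρ hlt hc hAdq hS hDs hQ) fun hQ => hD K n hcpt hn ih ℓ ι ρ hlt hc hAdq hS hDs hQ

end Summit.Langlands.Langlands.Theses.LieDefectSplit
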